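import Literature.Computability.Complexity.TranscriptChecker
import Literature.Computability.Complexity.DiagPrelims
import HarnessLib

/-!
# The diagonalizing machine, I: registers and routines

Literature / complexity toolkit (the machine `D` of the nondeterministic time hierarchy
theorem, `NTIMEHierarchyDiagonal.lean`, is assembled in `DiagMachine.lean` from the routines of
this file). Everything here is an `ACom Bool (DReg Kf)` structured stack program
(`SymbolPrograms.lean`) over ONE register file `DReg Kf` containing the registers `UChk.UR` of
the transcript checker `UChk.U` (`TranscriptChecker.lean`), `Kf` registers for the flat clock
program, and the working registers of `D`; stores are written as a structure `DSt` so that the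
effect of every routine is an equation between explicit stores.

Routines and their specifications (effect, and cost where the diagonalizer's linear running
time needs it):
* `unpairTr` — un-pairing a word `⟨y, t⟩ ↦ (y, t)` in place (`runs_unpairTr`, and
  `runs_unpairTr_none` on malformed words);
* `hdrFields` — reading the header fields `1^m 0 1^inp 0 1^out 0 1^E 0 code` into the
  registers of `U` (`runs_hdrFields`), with the code NORMALISED (`normCode`: an ill-formed code
  is replaced by the empty program, so that `U`'s specification always applies);
* `simCore` — the elementary check "does the word `v` un-pair into a witness `y` and a paid,
  accepted transcript for `U` on `⟨z, y⟩`?" (`runs_simCore`): this is `D`'s answer at the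
  simulated positions of a chain, and the predicate searched exhaustively at its end;
* `bsuccP` — the successor of the binary counter (`DiagPrelims.bsucc`), `mulP` — unary
  multiplication, and `search` — the exhaustive search: `res = [1]` iff some word of length
  `≤ N` passes `simCore` (`runs_search`; only its effect matters, it runs under fuel).

## References

* S. Arora, B. Barak, *Computational Complexity: A Modern Approach*, CUP 2009, Thm. 3.2
  (proof), §1.4.1.
* S. A. Cook, *A hierarchy for nondeterministic time complexity*, JCSS 7 (1973), §3.
-/

namespace Literature.Computability.Complexity

open Function ACom StackWhile

namespace Diag

variable {Kf : ℕ}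

/-- The register file of the diagonalizer: the checker's registers, the clock program's
registers, and the working registers. [folklore] -/
inductive DReg (Kf : ℕ)
  | u (r : UChk.UR)
  | pf (i : Fin Kf)
  | inreg
  | xx
  | xc
  | xr
  | hh
  | zz
  | bb
  | mm
  | ee
  | yr
  | bad
  | go
  | z1
  | z2
  | m1
  | m2
  | vd
  | res
  | nn
  | e1
  | e2
  | t1
  | t2
  | cur
  | tmp
  | grew
  | go2
  | c1
  | c2
  | mark
  | ans
  | w
  | kt
  | ones
  | c5
  | cd
  | sv
  | h2
  deriving DecidableEq, Fintype

/-- Programs of the diagonalizer's routines. [folklore] -/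
abbrev Prog (Kf : ℕ) : Type := ACom Bool (DReg Kf)

/-- Stores of the diagonalizer as a structure: the checker's store, the clock program's
registers, the working registers. [folklore] -/
structure DSt (Kf : ℕ) where
  u : UChk.USt := {}
  pf : Fin Kf → List Bool := fun _ => []
  inreg : List Bool := []
  xx : List Bool := []
  xc : List Bool := []
  xr : List Bool := []
  hh : List Bool := []
  zz : List Bool := []
  bb : List Bool := []
  mm : List Bool := []
  ee : List Bool := []
  yr : List Bool := []
  bad : List Bool := []
  go : List Bool := []
  z1 : List Bool := []
  z2 : List Bool := []
  m1 : List Bool := []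
  m2 : List Bool := []
  vd : List Bool := []
  res : List Bool := []
  nn : List Bool := []
  e1 : List Bool := []
  e2 : List Bool := []
  t1 : List Bool := []
  t2 : List Bool := []
  cur : List Bool := []
  tmp : List Bool := []
  grew : List Bool := []
  go2 : List Bool := []
  c1 : List Bool := []
  c2 : List Bool := []
  mark : List Bool := []
  ans : List Bool := []
  w : List Bool := []
  kt : List Bool := []
  ones : List Bool := []
  c5 : List Bool := []
  cd : List Bool := []
  sv : List Bool := []
  h2 : List Bool := []

namespace DSt

/-- The store of a structured store. [folklore] -/
def store (s : DSt Kf) : AStore Bool (DReg Kf)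
  | .u r => s.u.store r
  | .pf i => s.pf i
  | .inreg => s.inreg
  | .xx => s.xx
  | .xc => s.xc
  | .xr => s.xr
  | .hh => s.hh
  | .zz => s.zz
  | .bb => s.bb
  | .mm => s.mm
  | .ee => s.ee
  | .yr => s.yr
  | .bad => s.bad
  | .go => s.go
  | .z1 => s.z1
  | .z2 => s.z2
  | .m1 => s.m1
  | .m2 => s.m2
  | .vd => s.vd
  | .res => s.res
  | .nn => s.nn
  | .e1 => s.e1
  | .e2 => s.e2
  | .t1 => s.t1
  | .t2 => s.t2
  | .cur => s.cur
  | .tmp => s.tmp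
  | .grew => s.grew
  | .go2 => s.go2
  | .c1 => s.c1
  | .c2 => s.c2
  | .mark => s.mark
  | .ans => s.ans
  | .w => s.w
  | .kt => s.kt
  | .ones => s.ones
  | .c5 => s.c5
  | .cd => s.cd
  | .sv => s.sv
  | .h2 => s.h2

section Lemmas
variable (s : DSt Kf) (v : List Bool)

/-- Reading a checker register. [folklore] -/
@[simp] theorem store_u (r : UChk.UR) : s.store (.u r) = s.u.store r := rfl
/-- Reading a clock-program register. [folklore] -/
@[simp] theorem store_pf (i : Fin Kf) : s.store (.pf i) = s.pf i := rfl
/-- Reading `inreg`. [folklore] -/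
@[simp] theorem store_inreg : s.store .inreg = s.inreg := rfl
/-- Reading `xx`. [folklore] -/
@[simp] theorem store_xx : s.store .xx = s.xx := rfl
/-- Reading `xc`. [folklore] -/
@[simp] theorem store_xc : s.store .xc = s.xc := rfl
/-- Reading `xr`. [folklore] -/
@[simp] theorem store_xr : s.store .xr = s.xr := rfl
/-- Reading `hh`. [folklore] -/
@[simp] theorem store_hh : s.store .hh = s.hh := rfl
/-- Reading `zz`. [folklore] -/
@[simp] theorem store_zz : s.store .zz = s.zz := rfl
/-- Reading `bb`. [folklore] -/
@[simp] theorem store_bb : s.store .bb = s.bb := rfl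
/-- Reading `mm`. [folklore] -/
@[simp] theorem store_mm : s.store .mm = s.mm := rfl
/-- Reading `ee`. [folklore] -/
@[simp] theorem store_ee : s.store .ee = s.ee := rfl
/-- Reading `yr`. [folklore] -/
@[simp] theorem store_yr : s.store .yr = s.yr := rfl
/-- Reading `bad`. [folklore] -/
@[simp] theorem store_bad : s.store .bad = s.bad := rfl
/-- Reading `go`. [folklore] -/
@[simp] theorem store_go : s.store .go = s.go := rfl
/-- Reading `z1`. [folklore] -/
@[simp] theorem store_z1 : s.store .z1 = s.z1 := rfl
/-- Reading `z2`. [folklore] -/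
@[simp] theorem store_z2 : s.store .z2 = s.z2 := rfl
/-- Reading `m1`. [folklore] -/
@[simp] theorem store_m1 : s.store .m1 = s.m1 := rfl
/-- Reading `m2`. [folklore] -/
@[simp] theorem store_m2 : s.store .m2 = s.m2 := rfl
/-- Reading `vd`. [folklore] -/
@[simp] theorem store_vd : s.store .vd = s.vd := rfl
/-- Reading `res`. [folklore] -/
@[simp] theorem store_res : s.store .res = s.res := rfl
/-- Reading `nn`. [folklore] -/
@[simp] theorem store_nn : s.store .nn = s.nn := rfl
/-- Reading `e1`. [folklore] -/
@[simp] theorem store_e1 : s.store .e1 = s.e1 := rfl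
/-- Reading `e2`. [folklore] -/
@[simp] theorem store_e2 : s.store .e2 = s.e2 := rfl
/-- Reading `t1`. [folklore] -/
@[simp] theorem store_t1 : s.store .t1 = s.t1 := rfl
/-- Reading `t2`. [folklore] -/
@[simp] theorem store_t2 : s.store .t2 = s.t2 := rfl
/-- Reading `cur`. [folklore] -/
@[simp] theorem store_cur : s.store .cur = s.cur := rfl
/-- Reading `tmp`. [folklore] -/
@[simp] theorem store_tmp : s.store .tmp = s.tmp := rfl
/-- Reading `grew`. [folklore] -/
@[simp] theorem store_grew : s.store .grew = s.grew := rfl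
/-- Reading `go2`. [folklore] -/
@[simp] theorem store_go2 : s.store .go2 = s.go2 := rfl
/-- Reading `c1`. [folklore] -/
@[simp] theorem store_c1 : s.store .c1 = s.c1 := rfl
/-- Reading `c2`. [folklore] -/
@[simp] theorem store_c2 : s.store .c2 = s.c2 := rfl
/-- Reading `mark`. [folklore] -/
@[simp] theorem store_mark : s.store .mark = s.mark := rfl
/-- Reading `ans`. [folklore] -/
@[simp] theorem store_ans : s.store .ans = s.ans := rfl
/-- Reading `w`. [folklore] -/
@[simp] theorem store_w : s.store .w = s.w := rfl
/-- Reading `kt`. [folklore] -/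
@[simp] theorem store_kt : s.store .kt = s.kt := rfl
/-- Reading `ones`. [folklore] -/
@[simp] theorem store_ones : s.store .ones = s.ones := rfl
/-- Reading `c5`. [folklore] -/
@[simp] theorem store_c5 : s.store .c5 = s.c5 := rfl
/-- Reading `cd`. [folklore] -/
@[simp] theorem store_cd : s.store .cd = s.cd := rfl
/-- Reading `sv`. [folklore] -/
@[simp] theorem store_sv : s.store .sv = s.sv := rfl
/-- Reading `h2`. [folklore] -/
@[simp] theorem store_h2 : s.store .h2 = s.h2 := rfl
/-- Updating a clock-program register. [folklore] -/
@[simp] theorem update_store_pf (i : Fin Kf) : update s.store (.pf i) v = { s with pf := update s.pf i v }.store := by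
  funext r; cases r; all_goals simp [update_apply, store]
/-- Grafting a checker store. [folklore] -/
theorem graft_u (R : UChk.USt) : graft s.store DReg.u R.store = { s with u := R }.store := by
  funext r; cases r
  case u r => exact graft_apply _ (fun a b h => by simpa using h) _ _
  all_goals rw [graft_of_not _ _ _ (by simp)]; rfl
/-- Grafting the clock program's registers. [folklore] -/
theorem graft_pf (R : Fin Kf → List Bool) : graft s.store DReg.pf R = { s with pf := R }.store := by
  funext r; cases r
  case pf i => exact graft_apply _ (fun a b h => by simpa using h) _ _
  all_goals rw [graft_of_not _ _ _ (by simp)]; rfl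
/-- Updating `inreg`. [folklore] -/
@[simp] theorem update_store_inreg : update s.store .inreg v = { s with inreg := v }.store := by
  funext r; cases r; all_goals simp [store]
/-- Updating `xx`. [folklore] -/
@[simp] theorem update_store_xx : update s.store .xx v = { s with xx := v }.store := by
  funext r; cases r; all_goals simp [store]
/-- Updating `xc`. [folklore] -/
@[simp] theorem update_store_xc : update s.store .xc v = { s with xc := v }.store := by
  funext r; cases r; all_goals simp [store]
/-- Updating `xr`. [folklore] -/
@[simp] theorem update_store_xr : update s.store .xr v = { s with xr := v }.store := by
  funext r; cases r; all_goals simp [store]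
/-- Updating `hh`. [folklore] -/
@[simp] theorem update_store_hh : update s.store .hh v = { s with hh := v }.store := by
  funext r; cases r; all_goals simp [store]
/-- Updating `zz`. [folklore] -/
@[simp] theorem update_store_zz : update s.store .zz v = { s with zz := v }.store := by
  funext r; cases r; all_goals simp [store]
/-- Updating `bb`. [folklore] -/
@[simp] theorem update_store_bb : update s.store .bb v = { s with bb := v }.store := by
  funext r; cases r; all_goals simp [store]
/-- Updating `mm`. [folklore] -/
@[simp] theorem update_store_mm : update s.store .mm v = { s with mm := v }.store := by
  funext r; cases r; all_goals simp [store]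
/-- Updating `ee`. [folklore] -/
@[simp] theorem update_store_ee : update s.store .ee v = { s with ee := v }.store := by
  funext r; cases r; all_goals simp [store]
/-- Updating `yr`. [folklore] -/
@[simp] theorem update_store_yr : update s.store .yr v = { s with yr := v }.store := by
  funext r; cases r; all_goals simp [store]
/-- Updating `bad`. [folklore] -/
@[simp] theorem update_store_bad : update s.store .bad v = { s with bad := v }.store := by
  funext r; cases r; all_goals simp [store]
/-- Updating `go`. [folklore] -/
@[simp] theorem update_store_go : update s.store .go v = { s with go := v }.store := by
  funext r; cases r; all_goals simp [store]
/-- Updating `z1`. [folklore] -/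
@[simp] theorem update_store_z1 : update s.store .z1 v = { s with z1 := v }.store := by
  funext r; cases r; all_goals simp [store]
/-- Updating `z2`. [folklore] -/
@[simp] theorem update_store_z2 : update s.store .z2 v = { s with z2 := v }.store := by
  funext r; cases r; all_goals simp [store]
/-- Updating `m1`. [folklore] -/
@[simp] theorem update_store_m1 : update s.store .m1 v = { s with m1 := v }.store := by
  funext r; cases r; all_goals simp [store]
/-- Updating `m2`. [folklore] -/
@[simp] theorem update_store_m2 : update s.store .m2 v = { s with m2 := v }.store := by
  funext r; cases r; all_goals simp [store]
/-- Updating `vd`. [folklore] -/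
@[simp] theorem update_store_vd : update s.store .vd v = { s with vd := v }.store := by
  funext r; cases r; all_goals simp [store]
/-- Updating `res`. [folklore] -/
@[simp] theorem update_store_res : update s.store .res v = { s with res := v }.store := by
  funext r; cases r; all_goals simp [store]
/-- Updating `nn`. [folklore] -/
@[simp] theorem update_store_nn : update s.store .nn v = { s with nn := v }.store := by
  funext r; cases r; all_goals simp [store]
/-- Updating `e1`. [folklore] -/
@[simp] theorem update_store_e1 : update s.store .e1 v = { s with e1 := v }.store := by
  funext r; cases r; all_goals simp [store]
/-- Updating `e2`. [folklore] -/
@[simp] theorem update_store_e2 : update s.store .e2 v = { s with e2 := v }.store := by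
  funext r; cases r; all_goals simp [store]
/-- Updating `t1`. [folklore] -/
@[simp] theorem update_store_t1 : update s.store .t1 v = { s with t1 := v }.store := by
  funext r; cases r; all_goals simp [store]
/-- Updating `t2`. [folklore] -/
@[simp] theorem update_store_t2 : update s.store .t2 v = { s with t2 := v }.store := by
  funext r; cases r; all_goals simp [store]
/-- Updating `cur`. [folklore] -/
@[simp] theorem update_store_cur : update s.store .cur v = { s with cur := v }.store := by
  funext r; cases r; all_goals simp [store]
/-- Updating `tmp`. [folklore] -/
@[simp] theorem update_store_tmp : update s.store .tmp v = { s with tmp := v }.store := by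
  funext r; cases r; all_goals simp [store]
/-- Updating `grew`. [folklore] -/
@[simp] theorem update_store_grew : update s.store .grew v = { s with grew := v }.store := by
  funext r; cases r; all_goals simp [store]
/-- Updating `go2`. [folklore] -/
@[simp] theorem update_store_go2 : update s.store .go2 v = { s with go2 := v }.store := by
  funext r; cases r; all_goals simp [store]
/-- Updating `c1`. [folklore] -/
@[simp] theorem update_store_c1 : update s.store .c1 v = { s with c1 := v }.store := by
  funext r; cases r; all_goals simp [store]
/-- Updating `c2`. [folklore] -/
@[simp] theorem update_store_c2 : update s.store .c2 v = { s with c2 := v }.store := by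
  funext r; cases r; all_goals simp [store]
/-- Updating `mark`. [folklore] -/
@[simp] theorem update_store_mark : update s.store .mark v = { s with mark := v }.store := by
  funext r; cases r; all_goals simp [store]
/-- Updating `ans`. [folklore] -/
@[simp] theorem update_store_ans : update s.store .ans v = { s with ans := v }.store := by
  funext r; cases r; all_goals simp [store]
/-- Updating `w`. [folklore] -/
@[simp] theorem update_store_w : update s.store .w v = { s with w := v }.store := by
  funext r; cases r; all_goals simp [store]
/-- Updating `kt`. [folklore] -/
@[simp] theorem update_store_kt : update s.store .kt v = { s with kt := v }.store := by
  funext r; cases r; all_goals simp [store]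
/-- Updating `ones`. [folklore] -/
@[simp] theorem update_store_ones : update s.store .ones v = { s with ones := v }.store := by
  funext r; cases r; all_goals simp [store]
/-- Updating `c5`. [folklore] -/
@[simp] theorem update_store_c5 : update s.store .c5 v = { s with c5 := v }.store := by
  funext r; cases r; all_goals simp [store]
/-- Updating `cd`. [folklore] -/
@[simp] theorem update_store_cd : update s.store .cd v = { s with cd := v }.store := by
  funext r; cases r; all_goals simp [store]
/-- Updating `sv`. [folklore] -/
@[simp] theorem update_store_sv : update s.store .sv v = { s with sv := v }.store := by
  funext r; cases r; all_goals simp [store]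
/-- Updating `h2`. [folklore] -/
@[simp] theorem update_store_h2 : update s.store .h2 v = { s with h2 := v }.store := by
  funext r; cases r; all_goals simp [store]
/-- Updating the checker's `code`. [folklore] -/
@[simp] theorem update_store_u_code : update s.store (.u .code) v = { s with u := { s.u with code := v } }.store := by
  funext r; cases r
  case u r => cases r <;> simp [store, UChk.USt.store]
  all_goals simp [store]
/-- Updating the checker's `ky`. [folklore] -/
@[simp] theorem update_store_u_ky : update s.store (.u .ky) v = { s with u := { s.u with ky := v } }.store := by
  funext r; cases r
  case u r => cases r <;> simp [store, UChk.USt.store]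
  all_goals simp [store]
/-- Updating the checker's `np`. [folklore] -/
@[simp] theorem update_store_u_np : update s.store (.u .np) v = { s with u := { s.u with np := v } }.store := by
  funext r; cases r
  case u r => cases r <;> simp [store, UChk.USt.store]
  all_goals simp [store]
/-- Updating the checker's `tr`. [folklore] -/
@[simp] theorem update_store_u_tr : update s.store (.u .tr) v = { s with u := { s.u with tr := v } }.store := by
  funext r; cases r
  case u r => cases r <;> simp [store, UChk.USt.store]
  all_goals simp [store]
/-- Updating the checker's `inp`. [folklore] -/
@[simp] theorem update_store_u_inp : update s.store (.u .inp) v = { s with u := { s.u with inp := v } }.store := by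
  funext r; cases r
  case u r => cases r <;> simp [store, UChk.USt.store]
  all_goals simp [store]
/-- Updating the checker's `outr`. [folklore] -/
@[simp] theorem update_store_u_outr : update s.store (.u .outr) v = { s with u := { s.u with outr := v } }.store := by
  funext r; cases r
  case u r => cases r <;> simp [store, UChk.USt.store]
  all_goals simp [store]
/-- Updating the checker's `ini`. [folklore] -/
@[simp] theorem update_store_u_ini : update s.store (.u .ini) v = { s with u := { s.u with ini := v } }.store := by
  funext r; cases r
  case u r => cases r <;> simp [store, UChk.USt.store]
  all_goals simp [store]
/-- Updating the checker's `flag`. [folklore] -/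
@[simp] theorem update_store_u_flag : update s.store (.u .flag) v = { s with u := { s.u with flag := v } }.store := by
  funext r; cases r
  case u r => cases r <;> simp [store, UChk.USt.store]
  all_goals simp [store]
end Lemmas

end DSt

/-- Transport of the initial store of a run along an equation (generic form of the checker's
`Runs.start`). [folklore] -/
theorem _root_.Literature.Computability.Complexity.ACom.Runs.init {ι : Type} [DecidableEq ι] {c : ACom Bool ι}
    {R R₀ R' : AStore Bool ι} {B : ℕ} (h : Runs c R R' B) (e : R = R₀) : Runs c R₀ R' B := e ▸ h


/-! ### Size of stores along a run (generic) -/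

section Size

variable {ι : Type} [DecidableEq ι] [Fintype ι]

/-- The total size of a store. [folklore] -/
def ssize (R : AStore Bool ι) : ℕ := ∑ r, (R r).length

/-- Updating one register changes the size accordingly. [folklore] -/
theorem ssize_update (R : AStore Bool ι) (k : ι) (v : List Bool) :
    ssize (update R k v) + (R k).length = ssize R + v.length := by
  unfold ssize
  rw [← Finset.add_sum_erase Finset.univ (fun r => (update R k v r).length) (Finset.mem_univ k),
    ← Finset.add_sum_erase Finset.univ (fun r => (R r).length) (Finset.mem_univ k)]
  have h : ∑ r ∈ Finset.univ.erase k, (update R k v r).length = ∑ r ∈ Finset.univ.erase k, (R r).length :=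
    Finset.sum_congr rfl fun r hr => by rw [update_of_ne (Finset.ne_of_mem_erase hr)]
  rw [h, update_self]
  omega

/-- **A run of `t` steps grows the store by at most `t` symbols.** [folklore] -/
theorem _root_.Literature.Computability.Complexity.ACom.Exec.ssize_le {c : ACom Bool ι} {R R' : AStore Bool ι} {t : ℕ}
    (h : Exec c R R' t) : ssize R' ≤ ssize R + t := by
  induction h with
  | @push k a R => have := ssize_update R k (a :: R k); simp at this; omega
  | @pop_cons k f R R' a w t hk _ ih => have := ssize_update R k w; rw [hk] at this; simp at this; omega
  | pop_nil _ _ ih => omega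
  | seq _ _ ih₁ ih₂ => omega
  | skip => omega
  | loop_nil => omega
  | @loop_cons k f R R₁ R₂ a w t₁ t₂ hk _ _ ih₁ ih₂ => have := ssize_update R k w; rw [hk] at this; simp at this; omega

omit [DecidableEq ι] in
/-- One register is at most the size. [folklore] -/
theorem length_le_ssize (R : AStore Bool ι) (k : ι) : (R k).length ≤ ssize R := by
  unfold ssize
  exact Finset.single_le_sum (f := fun r => (R r).length) (fun _ _ => Nat.zero_le _) (Finset.mem_univ k)

end Size

/-! ### Un-pairing in place -/

/-- After the second symbol of a pair: an equal pair is a symbol of `y` (kept reversed on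
`yr`, loop refilled); `01` is the separator (stop); `10` is malformed. [folklore] -/
def pairBr : Bool → Option Bool → Prog Kf
  | true, some true => push .yr true ;; push .go true
  | false, some false => push .yr false ;; push .go true
  | false, some true => skip
  | true, some false => push .bad true
  | _, none => push .bad true

/-- After the first symbol of a pair. [folklore] -/
def fstBr : Option Bool → Prog Kf
  | some b => pop .xr (pairBr b)
  | none => push .bad true

/-- **Un-pairing in place**: `xr = ⟨y, t⟩ ↦ xr = t`, `y` reversed onto `yr`; a malformed word
raises `bad`. [folklore] -/
def unpairTr : Prog Kf := push .go true ;; loop .go fun _ => pop .xr fstBr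

/-- The loop of `unpairTr` on a pair word. [folklore] -/
theorem runs_unpairLoop (s : DSt Kf) (t : List Bool) : ∀ (y acc : List Bool),
    Runs (loop .go fun _ => pop .xr fstBr) { s with xr := boolPair y t, yr := acc, go := [true] }.store
      { s with xr := t, yr := y.reverse ++ acc, go := [] }.store (8 * y.length + 7)
  | [], acc => by
    let T : List Bool → List Bool → List Bool → DSt Kf := fun x a g => { s with xr := x, yr := a, go := g }
    have hs' : boolPair [] t = false :: true :: t := rfl
    have e2 : Runs (pairBr false (some true)) (T t acc []).store (T t acc []).store 0 := Runs.skip _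
    have e1 : Runs (fstBr (some false)) (T (true :: t) acc []).store (T t acc []).store (0 + 2) :=
      Runs.pop_cons' (f := pairBr false) (a := true) (w := t) (by simp [T]) (by simp [T]) e2
    have e0 : Runs (pop .xr fstBr) (T (false :: true :: t) acc []).store (T t acc []).store (0 + 2 + 2) :=
      Runs.pop_cons' (f := fstBr) (a := false) (w := true :: t) (by simp [T]) (by simp [T]) e1
    have h := Runs.loop_cons (k := DReg.go) (f := fun _ => pop .xr fstBr) (R := (T (false :: true :: t) acc [true]).store)
      (a := true) (w := []) (by simp [T]) (e0.init (by simp [T])) (Runs.loop_nil _ (by simp [T]))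
    exact h.of_eq (by simp [T]) (by simp)
  | b :: y, acc => by
    let T : List Bool → List Bool → List Bool → DSt Kf := fun x a g => { s with xr := x, yr := a, go := g }
    have hs' : boolPair (b :: y) t = b :: b :: boolPair y t := by simp [boolPair]
    have p1 : Runs (push DReg.yr b) (T (boolPair y t) acc []).store (T (boolPair y t) (b :: acc) []).store 1 :=
      Runs.push' (by simp [T])
    have p2 : Runs (push DReg.go true) (T (boolPair y t) (b :: acc) []).store (T (boolPair y t) (b :: acc) [true]).store 1 :=
      Runs.push' (by simp [T])
    have e2 : Runs (pairBr b (some b)) (T (boolPair y t) acc []).store (T (boolPair y t) (b :: acc) [true]).store (1 + 1) := by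
      cases b <;> exact p1.seq p2
    have e1 : Runs (fstBr (some b)) (T (b :: boolPair y t) acc []).store (T (boolPair y t) (b :: acc) [true]).store
        (1 + 1 + 2) := Runs.pop_cons' (f := pairBr b) (a := b) (w := boolPair y t) (by simp [T]) (by simp [T]) e2
    have e0 : Runs (pop .xr fstBr) (T (b :: b :: boolPair y t) acc []).store (T (boolPair y t) (b :: acc) [true]).store
        (1 + 1 + 2 + 2) := Runs.pop_cons' (f := fstBr) (a := b) (w := b :: boolPair y t) (by simp [T]) (by simp [T]) e1
    have ih := runs_unpairLoop s t y (b :: acc)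
    have h := Runs.loop_cons (k := DReg.go) (f := fun _ => pop .xr fstBr) (R := (T (b :: b :: boolPair y t) acc [true]).store)
      (a := true) (w := []) (by simp [T]) (e0.init (by simp [T])) ih
    refine (h.of_eq (by simp) ?_).init (by rw [hs'])
    simp only [List.length_cons]; omega

/-- **Effect and cost of `unpairTr` on a pair word.** [folklore] -/
theorem runs_unpairTr (s : DSt Kf) (y t acc : List Bool) :
    Runs unpairTr { s with xr := boolPair y t, yr := acc, go := [] }.store
      { s with xr := t, yr := y.reverse ++ acc, go := [] }.store (1 + (8 * y.length + 7)) := by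
  unfold unpairTr
  exact (Runs.push' (by simp)).seq (runs_unpairLoop s t y acc)

/-- The loop of `unpairTr` on a malformed word. [folklore] -/
theorem runs_unpairLoop_none (s : DSt Kf) : ∀ (n : ℕ) (v acc bd : List Bool), v.length ≤ n →
    DiagPrelims.unpair v = none → ∃ xr' yr' : List Bool,
      Runs (loop .go fun _ => pop .xr fstBr) { s with xr := v, yr := acc, go := [true], bad := bd }.store
        { s with xr := xr', yr := yr', go := [], bad := true :: bd }.store (8 * v.length + 7) ∧
      xr'.length + yr'.length ≤ v.length + acc.length := by
  intro n
  induction n using Nat.strong_induction_on with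
  | _ n ih =>
  intro v acc bd hn hu
  let T : List Bool → List Bool → List Bool → List Bool → DSt Kf := fun x a g b =>
    { s with xr := x, yr := a, go := g, bad := b }
  have LOOP : ∀ (x : List Bool) (B : ℕ) (x' a' : List Bool),
      Runs (pop .xr fstBr) (T x acc [] bd).store (T x' a' [] (true :: bd)).store B →
      Runs (loop .go fun _ => pop .xr fstBr) (T x acc [true] bd).store (T x' a' [] (true :: bd)).store (B + 2 + 1) :=
    fun x B x' a' e => Runs.loop_cons (k := DReg.go) (f := fun _ => pop .xr fstBr) (R := (T x acc [true] bd).store)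
      (a := true) (w := []) (by simp [T]) (e.init (by simp [T])) (Runs.loop_nil _ (by simp [T]))
  rcases v with _ | ⟨b, _ | ⟨b', rest⟩⟩
  · -- empty
    have e0 : Runs (pop .xr fstBr) (T [] acc [] bd).store (T [] acc [] (true :: bd)).store (1 + 2) :=
      Runs.pop_nil (by simp [T]) (Runs.push' (by simp [T]))
    exact ⟨[], acc, (LOOP _ _ _ _ e0).mono (by simp), by simp⟩
  · -- a single symbol
    have e1 : Runs (fstBr (some b)) (T [] acc [] bd).store (T [] acc [] (true :: bd)).store (1 + 2) :=
      Runs.pop_nil (by simp [T]) (by cases b <;> exact Runs.push' (by simp [T]))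
    have e0 : Runs (pop .xr fstBr) (T [b] acc [] bd).store (T [] acc [] (true :: bd)).store (1 + 2 + 2) :=
      Runs.pop_cons' (f := fstBr) (a := b) (w := []) (by simp [T]) (by simp [T]) e1
    exact ⟨[], acc, (LOOP _ _ _ _ e0).mono (by simp), by simp⟩
  · rw [DiagPrelims.unpair] at hu
    by_cases hbb : b = b'
    · -- an equal pair: a symbol of `y`, then recurse
      subst hbb
      rw [if_pos rfl] at hu
      have hu' : DiagPrelims.unpair rest = none := by
        cases h : DiagPrelims.unpair rest with
        | none => rfl
        | some p => rw [h] at hu; simp at hu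
      have p1 : Runs (push DReg.yr b) (T rest acc [] bd).store (T rest (b :: acc) [] bd).store 1 :=
        Runs.push' (by simp [T])
      have p2 : Runs (push DReg.go true) (T rest (b :: acc) [] bd).store (T rest (b :: acc) [true] bd).store 1 :=
        Runs.push' (by simp [T])
      have e2 : Runs (pairBr b (some b)) (T rest acc [] bd).store (T rest (b :: acc) [true] bd).store (1 + 1) := by
        cases b <;> exact p1.seq p2
      have e1 : Runs (fstBr (some b)) (T (b :: rest) acc [] bd).store (T rest (b :: acc) [true] bd).store (1 + 1 + 2) :=
        Runs.pop_cons' (f := pairBr b) (a := b) (w := rest) (by simp [T]) (by simp [T]) e2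
      have e0 : Runs (pop .xr fstBr) (T (b :: b :: rest) acc [] bd).store (T rest (b :: acc) [true] bd).store
          (1 + 1 + 2 + 2) := Runs.pop_cons' (f := fstBr) (a := b) (w := b :: rest) (by simp [T]) (by simp [T]) e1
      have hlen : rest.length < n := by simp at hn; omega
      obtain ⟨xr', yr', h', hl⟩ := ih rest.length hlen rest (b :: acc) bd le_rfl hu'
      refine ⟨xr', yr', ?_, by simp at hl ⊢; omega⟩
      have h := Runs.loop_cons (k := DReg.go) (f := fun _ => pop .xr fstBr) (R := (T (b :: b :: rest) acc [true] bd).store)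
        (a := true) (w := []) (by simp [T]) (e0.init (by simp [T])) h'
      exact h.of_eq rfl (by simp; omega)
    · rw [if_neg hbb] at hu
      cases b with
      | false => rw [if_pos rfl] at hu; exact absurd hu (by simp)
      | true =>
        have hb' : b' = false := by cases b' <;> simp_all
        subst hb'
        have e2 : Runs (pairBr true (some false)) (T rest acc [] bd).store (T rest acc [] (true :: bd)).store 1 :=
          Runs.push' (by simp [T])
        have e1 : Runs (fstBr (some true)) (T (false :: rest) acc [] bd).store (T rest acc [] (true :: bd)).store (1 + 2) :=
          Runs.pop_cons' (f := pairBr true) (a := false) (w := rest) (by simp [T]) (by simp [T]) e2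
        have e0 : Runs (pop .xr fstBr) (T (true :: false :: rest) acc [] bd).store (T rest acc [] (true :: bd)).store
            (1 + 2 + 2) :=
          Runs.pop_cons' (f := fstBr) (a := true) (w := false :: rest) (by simp [T]) (by simp [T]) e1
        exact ⟨rest, acc, (LOOP _ _ _ _ e0).mono (by simp; omega), by simp; omega⟩

/-- **Effect and cost of `unpairTr` on a malformed word**: `bad` is raised; the contents of
`xr` and `yr` do not grow in total. [folklore] -/
theorem runs_unpairTr_none (s : DSt Kf) (v acc bd : List Bool) (hu : DiagPrelims.unpair v = none) :
    ∃ xr' yr' : List Bool,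
      Runs unpairTr { s with xr := v, yr := acc, go := [], bad := bd }.store
        { s with xr := xr', yr := yr', go := [], bad := true :: bd }.store (1 + (8 * v.length + 7)) ∧
      xr'.length + yr'.length ≤ v.length + acc.length := by
  obtain ⟨xr', yr', h, hl⟩ := runs_unpairLoop_none s v.length v acc bd le_rfl hu
  refine ⟨xr', yr', ?_, hl⟩
  unfold unpairTr
  exact (Runs.push' (by simp)).seq h

/-! ### Reading unary fields and the code of the header -/

/-- The leading ones of a word and the rest (a block tail). [folklore] -/
def lead : List Bool → ℕ × List Bool
  | true :: l => ((lead l).1 + 1, (lead l).2)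
  | l => (0, l)

/-- `lead` on a word written as ones followed by a block tail. [folklore] -/
theorem lead_un_append {a : ℕ} {t : List Bool} (ht : IsTail t) : lead (un a ++ t) = (a, t) := by
  induction a with
  | zero => rcases ht with rfl | ⟨r, rfl⟩ <;> rfl
  | succ a ih =>
    have : un (a + 1) ++ t = true :: (un a ++ t) := by simp [un, List.replicate_succ]
    rw [this, lead, ih]

/-- What `readBlock` reads from a word: the leading ones; and what it leaves: the rest without
its terminator. [folklore] -/
def rdNum (l : List Bool) : ℕ × List Bool := ((lead l).1, (lead l).2.tail)

/-- The number read is at most the length of the word, and the rest is shorter by more.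
[folklore] -/
theorem rdNum_le (l : List Bool) : (rdNum l).1 + (rdNum l).2.length ≤ l.length := by
  obtain ⟨a, t, ht, rfl⟩ := exists_un_append_isTail l
  rw [rdNum, lead_un_append ht]
  rcases ht with rfl | ⟨r, rfl⟩ <;> simp [un]

/-- Reading a block of a genuine field. [folklore] -/
theorem rdNum_blk (a : ℕ) (rest : List Bool) : rdNum (UChk.blk a ++ rest) = (a, rest) := by
  rw [rdNum, UChk.blk, List.append_assoc, List.singleton_append, lead_un_append (Or.inr ⟨rest, rfl⟩)]
  rfl

/-- **`readBlock` from `bb`** on structured stores. [folklore] -/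
theorem runs_readBlock_bb (s : DSt Kf) {dst : DReg Kf} (hd1 : dst ≠ .bb) (hd2 : dst ≠ .w) (l : List Bool) :
    Runs (readBlock .bb dst .w) { s with bb := l, w := [] }.store
      (update { s with bb := (rdNum l).2, w := [] }.store dst (un (rdNum l).1 ++ { s with bb := l, w := [] }.store dst))
      (6 * (rdNum l).1 + 6) := by
  obtain ⟨a, t, ht, rfl⟩ := exists_un_append_isTail l
  have hrd : rdNum (un a ++ t) = (a, t.tail) := by rw [rdNum, lead_un_append ht]
  obtain ⟨R', h, g1, g2, g3, g4⟩ := runs_readBlock (src := DReg.bb) (dst := dst) (w := DReg.w) (by simp) hd2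
    (Ne.symm hd1) (a := a) (t := t) ht { s with bb := un a ++ t, w := [] }.store (by simp) (by simp)
  rw [hrd]
  refine h.of_eq ?_ le_rfl
  funext r
  by_cases h1 : r = dst
  · subst h1; rw [update_self, g2]
  · rw [update_of_ne h1]
    by_cases h2 : r = DReg.bb
    · subst h2; rw [g1]; simp
    · by_cases h3 : r = DReg.w
      · subst h3; rw [g3]; simp
      · rw [g4 r h2 h1 h3]
        have e1 : ({ s with bb := un a ++ t, w := [] } : DSt Kf).store r = s.store r := by
          have := congrFun (DSt.update_store_bb { s with w := [] } (un a ++ t)) r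
          rw [update_of_ne h2] at this
          have h' := congrFun (DSt.update_store_w s []) r
          rw [update_of_ne h3] at h'
          rw [← this, ← h']
        have e2 : ({ s with bb := t.tail, w := [] } : DSt Kf).store r = s.store r := by
          have := congrFun (DSt.update_store_bb { s with w := [] } t.tail) r
          rw [update_of_ne h2] at this
          have h' := congrFun (DSt.update_store_w s []) r
          rw [update_of_ne h3] at h'
          rw [← this, ← h']
        rw [e1, e2]

/-- Reading an instruction: five blocks. [folklore] -/
def rdInstr (l : List Bool) : UFlat.UInstr × List Bool :=
  let r1 := rdNum l
  let r2 := rdNum r1.2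
  let r3 := rdNum r2.2
  let r4 := rdNum r3.2
  let r5 := rdNum r4.2
  (⟨r1.1, r2.1, r3.1, r4.1, r5.1⟩, r5.2)

/-- Reading `q` instructions. [folklore] -/
def rdProg : ℕ → List Bool → UFlat.UProg × List Bool
  | 0, l => ([], l)
  | q + 1, l => ((rdInstr l).1 :: (rdProg q (rdInstr l).2).1, (rdProg q (rdInstr l).2).2)

/-- Reading a genuine instruction. [folklore] -/
theorem rdInstr_encInstr (i : UFlat.UInstr) (rest : List Bool) : rdInstr (UChk.encInstr i ++ rest) = (i, rest) := by
  obtain ⟨a1, a2, a3, a4, a5⟩ := i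
  simp only [rdInstr, UChk.encInstr, List.append_assoc, rdNum_blk]

/-- Reading a genuine program. [folklore] -/
theorem rdProg_encProg (P : UFlat.UProg) (rest : List Bool) : rdProg P.length (UChk.encProg P ++ rest) = (P, rest) := by
  induction P with
  | nil => simp [rdProg, UChk.encProg]
  | cons i P ih => rw [UChk.encProg_cons, List.append_assoc, List.length_cons, rdProg, rdInstr_encInstr, ih]

/-- The rest after reading instructions is a suffix. [folklore] -/
theorem rdInstr_le (l : List Bool) :
    (rdInstr l).1.act + (rdInstr l).1.k + (rdInstr l).1.j0 + (rdInstr l).1.j1 + (rdInstr l).1.j2 + (rdInstr l).2.length ≤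
      l.length := by
  have h1 := rdNum_le l
  have h2 := rdNum_le (rdNum l).2
  have h3 := rdNum_le (rdNum (rdNum l).2).2
  have h4 := rdNum_le (rdNum (rdNum (rdNum l).2).2).2
  have h5 := rdNum_le (rdNum (rdNum (rdNum (rdNum l).2).2).2).2
  simp only [rdInstr]; omega

/-- The code read is not longer than five times the instruction count plus the word.
[folklore] -/
theorem length_encProg_rdProg (q : ℕ) : ∀ l : List Bool,
    (UChk.encProg (rdProg q l).1).length + (rdProg q l).2.length ≤ l.length + 5 * q := by
  induction q with
  | zero => intro l; simp [rdProg, UChk.encProg]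
  | succ q ih =>
    intro l
    have h1 := rdInstr_le l
    have h2 := ih (rdInstr l).2
    rw [rdProg, UChk.encProg_cons, List.length_append]
    simp only [UChk.encInstr, UChk.blk, un, List.length_append, List.length_replicate, List.length_singleton]
    omega

/-- `rb`: read one block from `bb`, append it (reversed) to the reversed code on `cd`.
[folklore] -/
def rb : Prog Kf := readBlock .bb .kt .w ;; pour .kt .cd ;; push .cd false

/-- Effect and cost of `rb`. [folklore] -/
theorem runs_rb (s : DSt Kf) (l c : List Bool) :
    Runs rb { s with bb := l, w := [], kt := [], cd := c }.store
      { s with bb := (rdNum l).2, w := [], kt := [], cd := false :: (un (rdNum l).1 ++ c) }.store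
      (6 * (rdNum l).1 + 6 + (3 * (rdNum l).1 + 1 + 1)) := by
  unfold rb
  have h1 : Runs (readBlock .bb .kt .w) ({ s with bb := l, w := [], kt := [], cd := c } : DSt Kf).store
      ({ s with bb := (rdNum l).2, w := [], kt := un (rdNum l).1, cd := c } : DSt Kf).store (6 * (rdNum l).1 + 6) :=
    (runs_readBlock_bb { s with kt := [], cd := c } (dst := DReg.kt) (by simp) (by simp) l).of_eq (by simp) le_rfl
  have h2 : Runs (pour .kt .cd) ({ s with bb := (rdNum l).2, w := [], kt := un (rdNum l).1, cd := c } : DSt Kf).store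
      ({ s with bb := (rdNum l).2, w := [], kt := [], cd := un (rdNum l).1 ++ c } : DSt Kf).store (3 * (rdNum l).1 + 1) :=
    (runs_pour (Γ := Bool) (a := DReg.kt) (b := DReg.cd) (by simp) _).of_eq (by simp [un]) (by simp [un])
  have h3 : Runs (push DReg.cd false) ({ s with bb := (rdNum l).2, w := [], kt := [], cd := un (rdNum l).1 ++ c } : DSt Kf).store
      { s with bb := (rdNum l).2, w := [], kt := [], cd := false :: (un (rdNum l).1 ++ c) }.store 1 := Runs.push' (by simp)
  exact h1.seq (h2.seq h3)

/-- `rb5`: read one instruction. [folklore] -/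
def rb5 : Prog Kf := rb ;; rb ;; rb ;; rb ;; rb

/-- Effect and cost of `rb5`. [folklore] -/
theorem runs_rb5 (s : DSt Kf) (l c : List Bool) :
    Runs rb5 { s with bb := l, w := [], kt := [], cd := c }.store
      { s with bb := (rdInstr l).2, w := [], kt := [], cd := (UChk.encInstr (rdInstr l).1).reverse ++ c }.store
      (9 * ((rdInstr l).1.act + (rdInstr l).1.k + (rdInstr l).1.j0 + (rdInstr l).1.j1 + (rdInstr l).1.j2) + 40) := by
  have STEP : ∀ l c : List Bool, Runs rb ({ s with bb := l, w := [], kt := [], cd := c } : DSt Kf).store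
      ({ s with bb := (rdNum l).2, w := [], kt := [], cd := false :: (un (rdNum l).1 ++ c) } : DSt Kf).store
      (9 * (rdNum l).1 + 8) := fun l c => (runs_rb s l c).mono (by omega)
  unfold rb5
  refine Runs.of_eq ((STEP l c).seq ((STEP _ _).seq ((STEP _ _).seq ((STEP _ _).seq (STEP _ _))))) ?_ ?_
  · simp [rdInstr, UChk.encInstr, UChk.blk, un]
  · simp only [rdInstr]; omega

/-- Reading instructions only consumes. [folklore] -/
theorem length_rdProg_le (q : ℕ) : ∀ l : List Bool, (rdProg q l).2.length ≤ l.length := by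
  induction q with
  | zero => intro l; simp [rdProg]
  | succ q ih => intro l; have h1 := rdInstr_le l; have h2 := ih (rdInstr l).2; rw [rdProg]; simp only; omega

/-- `rdCode`: read `|e1|` instructions. [folklore] -/
def rdCode : Prog Kf := loop .e1 fun _ => rb5

/-- Effect and cost of `rdCode`. [folklore] -/
theorem runs_rdCode (s : DSt Kf) : ∀ (q : ℕ) (l c : List Bool),
    Runs rdCode { s with e1 := un q, bb := l, w := [], kt := [], cd := c }.store
      { s with e1 := [], bb := (rdProg q l).2, w := [], kt := [], cd := (UChk.encProg (rdProg q l).1).reverse ++ c }.store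
      (9 * (l.length - (rdProg q l).2.length) + 42 * q + 1)
  | 0, l, c => by
    have h := Runs.loop_nil (fun _ => (rb5 : Prog Kf)) (k := DReg.e1)
      (R := ({ s with e1 := [], bb := l, w := [], kt := [], cd := c } : DSt Kf).store) (by simp)
    exact h.of_eq (by simp [rdProg, UChk.encProg]) (by omega)
  | q + 1, l, c => by
    have e := runs_rb5 { s with e1 := un q } l c
    have ih := runs_rdCode s q (rdInstr l).2 ((UChk.encInstr (rdInstr l).1).reverse ++ c)
    have h := Runs.loop_cons (k := DReg.e1) (f := fun _ => (rb5 : Prog Kf))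
      (R := ({ s with e1 := un (q + 1), bb := l, w := [], kt := [], cd := c } : DSt Kf).store) (a := true) (w := un q)
      (by simp [un, List.replicate_succ]) (e.init (by simp)) ih
    have hle := rdInstr_le l
    have hle' := length_rdProg_le q (rdInstr l).2
    refine h.of_eq ?_ ?_
    · simp [rdProg, UChk.encProg_cons]
    · rw [rdProg]; simp only; omega

/-- The header fields `1^m 0 1^inp 0 1^out 0 1^E 0 1^q 0 code…` of a word: the numbers read by
`readBlock`, and the program of the `q` instructions read from the code (missing blocks read as
`0`, which NORMALISES every word into a genuine program). [folklore] -/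
structure HdrV where
  /-- number of passes -/
  m : ℕ
  /-- input register -/
  inp : ℕ
  /-- output register -/
  out : ℕ
  /-- search multiplier -/
  E : ℕ
  /-- the program -/
  P : UFlat.UProg

/-- Reading the header fields of a word. [folklore] -/
def hdrOf (b : List Bool) : HdrV :=
  let r1 := rdNum b
  let r2 := rdNum r1.2
  let r3 := rdNum r2.2
  let r4 := rdNum r3.2
  let r5 := rdNum r4.2
  ⟨r1.1, r2.1, r3.1, r4.1, (rdProg r5.1 r5.2).1⟩

/-- The genuine header word of given fields. [folklore] -/
def hdrWord (m inp out E : ℕ) (P : UFlat.UProg) : List Bool :=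
  UChk.blk m ++ UChk.blk inp ++ UChk.blk out ++ UChk.blk E ++ UChk.blk P.length ++ UChk.encProg P

/-- Reading a genuine header word (followed by anything). [folklore] -/
theorem hdrOf_hdrWord (m inp out E : ℕ) (P : UFlat.UProg) (rest : List Bool) :
    hdrOf (hdrWord m inp out E P ++ rest) = ⟨m, inp, out, E, P⟩ := by
  simp only [hdrOf, hdrWord, List.append_assoc, rdNum_blk, rdProg_encProg]

/-- The fields are bounded by the word. [folklore] -/
theorem hdrOf_le (b : List Bool) :
    (hdrOf b).m + (hdrOf b).inp + (hdrOf b).out + (hdrOf b).E + (UChk.encProg (hdrOf b).P).length ≤ 6 * b.length := by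
  have h1 := rdNum_le b
  have h2 := rdNum_le (rdNum b).2
  have h3 := rdNum_le (rdNum (rdNum b).2).2
  have h4 := rdNum_le (rdNum (rdNum (rdNum b).2).2).2
  have h5 := rdNum_le (rdNum (rdNum (rdNum (rdNum b).2).2).2).2
  have h6 := length_encProg_rdProg (rdNum (rdNum (rdNum (rdNum (rdNum b).2).2).2).2).1
    (rdNum (rdNum (rdNum (rdNum (rdNum b).2).2).2).2).2
  simp only [hdrOf]; omega

/-- `mkKy`: the yardstick `ky := 1^{out + inp + m}` from the three fields (non-destructively).
[folklore] -/
def mkKy : Prog Kf :=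
  copy2 .mm .t1 .t2 ;; pour .t1 .mm ;; pour .t2 (.u .ky) ;;
  copy2 (.u .inp) .t1 .t2 ;; pour .t1 (.u .inp) ;; pour .t2 (.u .ky) ;;
  copy2 (.u .outr) .t1 .t2 ;; pour .t1 (.u .outr) ;; pour .t2 (.u .ky)

/-- Effect and cost of `mkKy`. [folklore] -/
theorem runs_mkKy (s : DSt Kf) (m inp out : ℕ) :
    Runs mkKy { s with mm := un m, t1 := [], t2 := [], u := { s.u with inp := un inp, outr := un out, ky := [] } }.store
      { s with mm := un m, t1 := [], t2 := [], u := { s.u with inp := un inp, outr := un out, ky := un (out + inp + m) } }.store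
      ((4 * m + 1 + (3 * m + 1 + (3 * m + 1))) + ((4 * inp + 1 + (3 * inp + 1 + (3 * inp + 1))) +
        (4 * out + 1 + (3 * out + 1 + (3 * out + 1))))) := by
  -- the stores met: `T a b c t1 t2 k`
  let T : List Bool → List Bool → List Bool → List Bool → List Bool → List Bool → DSt Kf := fun a b c t1 t2 k =>
    { s with mm := a, t1 := t1, t2 := t2, u := { s.u with inp := b, outr := c, ky := k } }
  -- block 1: `mm`
  have a1 : Runs (copy2 .mm .t1 .t2) (T (un m) (un inp) (un out) [] [] []).store (T [] (un inp) (un out) (un m) (un m) []).store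
      (4 * m + 1) :=
    (runs_copy2 (Γ := Bool) (a := DReg.mm) (b := DReg.t1) (c := DReg.t2) (by simp) (by simp) (by simp) _).of_eq
      (by simp [T, un]) (by simp [T, un])
  have a2 : Runs (pour .t1 .mm) (T [] (un inp) (un out) (un m) (un m) []).store (T (un m) (un inp) (un out) [] (un m) []).store
      (3 * m + 1) :=
    (runs_pour (Γ := Bool) (a := DReg.t1) (b := DReg.mm) (by simp) _).of_eq (by simp [T, un]) (by simp [T, un])
  have a3 : Runs (pour .t2 (.u .ky)) (T (un m) (un inp) (un out) [] (un m) []).store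
      (T (un m) (un inp) (un out) [] [] (un m)).store (3 * m + 1) :=
    (runs_pour (Γ := Bool) (a := DReg.t2) (b := DReg.u .ky) (by simp) _).of_eq (by simp [T, un]) (by simp [T, un])
  -- block 2: `inp`
  have b1 : Runs (copy2 (.u .inp) .t1 .t2) (T (un m) (un inp) (un out) [] [] (un m)).store
      (T (un m) [] (un out) (un inp) (un inp) (un m)).store (4 * inp + 1) :=
    (runs_copy2 (Γ := Bool) (a := DReg.u .inp) (b := DReg.t1) (c := DReg.t2) (by simp) (by simp) (by simp) _).of_eq
      (by simp [T, un]) (by simp [T, un])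
  have b2 : Runs (pour .t1 (.u .inp)) (T (un m) [] (un out) (un inp) (un inp) (un m)).store
      (T (un m) (un inp) (un out) [] (un inp) (un m)).store (3 * inp + 1) :=
    (runs_pour (Γ := Bool) (a := DReg.t1) (b := DReg.u .inp) (by simp) _).of_eq (by simp [T, un]) (by simp [T, un])
  have b3 : Runs (pour .t2 (.u .ky)) (T (un m) (un inp) (un out) [] (un inp) (un m)).store
      (T (un m) (un inp) (un out) [] [] (un (inp + m))).store (3 * inp + 1) :=
    (runs_pour (Γ := Bool) (a := DReg.t2) (b := DReg.u .ky) (by simp) _).of_eq (by simp [T, un])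
      (by simp [T, un])
  -- block 3: `outr`
  have c1 : Runs (copy2 (.u .outr) .t1 .t2) (T (un m) (un inp) (un out) [] [] (un (inp + m))).store
      (T (un m) (un inp) [] (un out) (un out) (un (inp + m))).store (4 * out + 1) :=
    (runs_copy2 (Γ := Bool) (a := DReg.u .outr) (b := DReg.t1) (c := DReg.t2) (by simp) (by simp) (by simp) _).of_eq
      (by simp [T, un]) (by simp [T, un])
  have c2 : Runs (pour .t1 (.u .outr)) (T (un m) (un inp) [] (un out) (un out) (un (inp + m))).store
      (T (un m) (un inp) (un out) [] (un out) (un (inp + m))).store (3 * out + 1) :=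
    (runs_pour (Γ := Bool) (a := DReg.t1) (b := DReg.u .outr) (by simp) _).of_eq (by simp [T, un]) (by simp [T, un])
  have c3 : Runs (pour .t2 (.u .ky)) (T (un m) (un inp) (un out) [] (un out) (un (inp + m))).store
      (T (un m) (un inp) (un out) [] [] (un (out + inp + m))).store (3 * out + 1) :=
    (runs_pour (Γ := Bool) (a := DReg.t2) (b := DReg.u .ky) (by simp) _).of_eq
      (by simp [T, un, Nat.add_assoc]) (by simp [T, un])
  unfold mkKy
  refine Runs.mono (a1.seq (a2.seq (a3.seq (b1.seq (b2.seq (b3.seq (c1.seq (c2.seq c3)))))))) ?_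
  omega

/-- **`hdrFields`**: read the header fields into the registers of the checker and of the search.
[folklore] -/
def hdrFields : Prog Kf :=
  readBlock .bb .mm .w ;; readBlock .bb (.u .inp) .w ;; readBlock .bb (.u .outr) .w ;; readBlock .bb .ee .w ;;
  readBlock .bb .e1 .w ;; rdCode ;; pour .cd (.u .code) ;; clear .bb ;; mkKy

/-- The store after reading the header fields of `b`. [folklore] -/
def hdrSt (s : DSt Kf) (b : List Bool) : DSt Kf :=
  { s with bb := [], mm := un (hdrOf b).m, ee := un (hdrOf b).E, e1 := [], w := [], kt := [], cd := [], t1 := [], t2 := []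
           u := { s.u with inp := un (hdrOf b).inp, outr := un (hdrOf b).out
                           ky := un ((hdrOf b).out + (hdrOf b).inp + (hdrOf b).m), code := UChk.encProg (hdrOf b).P } }

/-- **Effect and cost of `hdrFields`.** [folklore] -/
theorem runs_hdrFields (s : DSt Kf) (b : List Bool) :
    Runs hdrFields
      { s with bb := b, mm := [], ee := [], e1 := [], w := [], kt := [], cd := [], t1 := [], t2 := []
               u := { s.u with inp := [], outr := [], ky := [], code := [] } }.store
      (hdrSt s b).store (130 * b.length + 60) := by
  -- the stores met
  let T : List Bool → List Bool → List Bool → List Bool → List Bool → List Bool → List Bool → List Bool → List Bool →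
      List Bool → DSt Kf := fun bb mm inp out ee e1 cd code ky _ =>
    { s with bb := bb, mm := mm, ee := ee, e1 := e1, w := [], kt := [], cd := cd, t1 := [], t2 := []
             u := { s.u with inp := inp, outr := out, ky := ky, code := code } }
  -- abbreviations for the successive rests
  have hb1 := rdNum_le b
  set n1 := (rdNum b).1 with hn1
  set l1 := (rdNum b).2 with hl1
  have hb2 := rdNum_le l1
  set n2 := (rdNum l1).1 with hn2
  set l2 := (rdNum l1).2 with hl2
  have hb3 := rdNum_le l2
  set n3 := (rdNum l2).1 with hn3
  set l3 := (rdNum l2).2 with hl3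
  have hb4 := rdNum_le l3
  set n4 := (rdNum l3).1 with hn4
  set l4 := (rdNum l3).2 with hl4
  have hb5 := rdNum_le l4
  set n5 := (rdNum l4).1 with hn5
  set l5 := (rdNum l4).2 with hl5
  have hb6 := length_encProg_rdProg n5 l5
  have hb7 := length_rdProg_le n5 l5
  set P := (rdProg n5 l5).1 with hP
  set l6 := (rdProg n5 l5).2 with hl6
  have hH : hdrOf b = ⟨n1, n2, n3, n4, P⟩ := by simp only [hdrOf, hn1, hl1, hn2, hl2, hn3, hl3, hn4, hl4, hn5, hl5, hP]
  have e1 : Runs (readBlock .bb .mm .w) (T b [] [] [] [] [] [] [] [] []).store (T l1 (un n1) [] [] [] [] [] [] [] []).store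
      (6 * n1 + 6) :=
    (runs_readBlock_bb (T b [] [] [] [] [] [] [] [] []) (dst := DReg.mm) (by simp) (by simp) b).of_eq (by simp [T, hn1, hl1])
      (by rw [hn1])
  have e2 : Runs (readBlock .bb (.u .inp) .w) (T l1 (un n1) [] [] [] [] [] [] [] []).store
      (T l2 (un n1) (un n2) [] [] [] [] [] [] []).store (6 * n2 + 6) :=
    (runs_readBlock_bb (T l1 (un n1) [] [] [] [] [] [] [] []) (dst := DReg.u .inp) (by simp) (by simp) l1).of_eq
      (by simp [T, hn2, hl2]) (by rw [hn2])
  have e3 : Runs (readBlock .bb (.u .outr) .w) (T l2 (un n1) (un n2) [] [] [] [] [] [] []).store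
      (T l3 (un n1) (un n2) (un n3) [] [] [] [] [] []).store (6 * n3 + 6) :=
    (runs_readBlock_bb (T l2 (un n1) (un n2) [] [] [] [] [] [] []) (dst := DReg.u .outr) (by simp) (by simp) l2).of_eq
      (by simp [T, hn3, hl3]) (by rw [hn3])
  have e4 : Runs (readBlock .bb .ee .w) (T l3 (un n1) (un n2) (un n3) [] [] [] [] [] []).store
      (T l4 (un n1) (un n2) (un n3) (un n4) [] [] [] [] []).store (6 * n4 + 6) :=
    (runs_readBlock_bb (T l3 (un n1) (un n2) (un n3) [] [] [] [] [] []) (dst := DReg.ee) (by simp) (by simp) l3).of_eq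
      (by simp [T, hn4, hl4]) (by rw [hn4])
  have e5 : Runs (readBlock .bb .e1 .w) (T l4 (un n1) (un n2) (un n3) (un n4) [] [] [] [] []).store
      (T l5 (un n1) (un n2) (un n3) (un n4) (un n5) [] [] [] []).store (6 * n5 + 6) :=
    (runs_readBlock_bb (T l4 (un n1) (un n2) (un n3) (un n4) [] [] [] [] []) (dst := DReg.e1) (by simp) (by simp) l4).of_eq
      (by simp [T, hn5, hl5]) (by rw [hn5])
  have e6 : Runs rdCode (T l5 (un n1) (un n2) (un n3) (un n4) (un n5) [] [] [] []).store
      (T l6 (un n1) (un n2) (un n3) (un n4) [] (UChk.encProg P).reverse [] [] []).store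
      (9 * (l5.length - l6.length) + 42 * n5 + 1) :=
    (runs_rdCode (T l5 (un n1) (un n2) (un n3) (un n4) [] [] [] [] []) n5 l5 []).of_eq (by simp [T, hP, hl6]) (by rw [hl6])
      |>.init (by simp [T])
  have e7 : Runs (pour .cd (.u .code)) (T l6 (un n1) (un n2) (un n3) (un n4) [] (UChk.encProg P).reverse [] [] []).store
      (T l6 (un n1) (un n2) (un n3) (un n4) [] [] (UChk.encProg P) [] []).store (3 * (UChk.encProg P).length + 1) :=
    (runs_pour (Γ := Bool) (a := DReg.cd) (b := DReg.u .code) (by simp) _).of_eq (by simp [T]) (by simp [T])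
  have e8 : Runs (clear .bb) (T l6 (un n1) (un n2) (un n3) (un n4) [] [] (UChk.encProg P) [] []).store
      (T [] (un n1) (un n2) (un n3) (un n4) [] [] (UChk.encProg P) [] []).store (2 * l6.length + 1) :=
    (runs_clear (Γ := Bool) DReg.bb _).of_eq (by simp [T]) (by simp [T])
  have e9 := runs_mkKy (T [] (un n1) (un n2) (un n3) (un n4) [] [] (UChk.encProg P) [] []) n1 n2 n3
  have e9' : Runs mkKy (T [] (un n1) (un n2) (un n3) (un n4) [] [] (UChk.encProg P) [] []).store
      (T [] (un n1) (un n2) (un n3) (un n4) [] [] (UChk.encProg P) (un (n3 + n2 + n1)) []).store _ :=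
    (e9.of_eq (by simp [T]) le_rfl).init (by simp [T])
  unfold hdrFields
  refine Runs.of_eq (e1.seq (e2.seq (e3.seq (e4.seq (e5.seq (e6.seq (e7.seq (e8.seq e9')))))))) ?_ ?_
  · simp [hdrSt, hH, T]
  · omega

/-! ### The elementary check `simCore` -/

/-- Doubling the symbols of `z1` onto the checker's `ini`. [folklore] -/
def iniLoop : Prog Kf := loop .z1 fun b => push (.u .ini) b ;; push (.u .ini) b

/-- Effect and cost of `iniLoop`. [folklore] -/
theorem runs_iniLoop (s : DSt Kf) (z acc : List Bool) :
    Runs iniLoop { s with z1 := z.reverse, u := { s.u with ini := acc } }.store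
      { s with z1 := [], u := { s.u with ini := (z.flatMap fun b => [b, b]) ++ acc } }.store (4 * z.length + 1) := by
  have h := runs_loop_inv (k := DReg.z1) (f := fun b => push (.u .ini) b ;; push (.u .ini) b)
    (fun done rest => ({ s with z1 := rest, u := { s.u with ini := (done.flatMap fun b => [b, b]) ++ acc } } : DSt Kf).store)
    (fun _ _ => True) 2 (fun _ _ _ => by simp)
    (fun done a rest _ => ⟨trivial, by
      refine Runs.seq (R₁ := ({ s with z1 := rest, u := { s.u with ini := a :: ((done.flatMap fun b => [b, b]) ++ acc) } } :
        DSt Kf).store) (Runs.push' (by simp)) (Runs.push' (by simp))⟩)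
    z.reverse [] trivial
  exact (h.of_eq (by simp) (by simp)).init (by simp)

/-- After the checker: an empty `flag` is a positive verdict. [folklore] -/
def flagBr : Option Bool → Prog Kf
  | none => push .vd true
  | some _ => clear (.u .flag)

/-- A malformed word: clean up, no verdict. [folklore] -/
def failB : Prog Kf := clear .bad ;; clear .xr ;; clear .yr

/-- A pair word `⟨y, t⟩`: feed the checker with `ini := ⟨z, y⟩`, `tr := t`, `np := 1^m`, run it,
read its flag. [folklore] -/
def okB : Prog Kf :=
  pour .xr .t1 ;; pour .t1 (.u .tr) ;; pour .yr (.u .ini) ;; push (.u .ini) true ;; push (.u .ini) false ;;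
  copy2 .zz .z1 .z2 ;; pour .z2 .zz ;; iniLoop ;; copy2 .mm .m1 .m2 ;; pour .m2 .mm ;; pour .m1 (.u .np) ;;
  UChk.U.map DReg.u ;; clear (.u .ini) ;; pop (.u .flag) flagBr

/-- Dispatch on `bad`. [folklore] -/
def badBr : Option Bool → Prog Kf
  | some _ => failB
  | none => okB

/-- **`simCore`**: does the word on `xr` un-pair into `⟨y, t⟩` with `t` a paid transcript
accepted by the checker on input `⟨z, y⟩`? The verdict is left on `vd` (`[1]` or `[]`).
[cite: AroraBarak2009, Thm. 3.2 (proof)] -/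
def simCore : Prog Kf := unpairTr ;; pop .bad badBr

/-- The input store of `simCore`. [folklore] -/
def scSt (s : DSt Kf) (P : UFlat.UProg) (K m inp out : ℕ) (z v : List Bool) : DSt Kf :=
  { s with xr := v, yr := [], go := [], bad := [], t1 := [], z1 := [], z2 := [], m1 := [], m2 := [], vd := [], zz := z
           mm := un m, u := { UChk.U0 P K m inp out [] [] with np := [] } }

/-- The verdict of `simCore`. [folklore] -/
def SimOK (P : UFlat.UProg) (K m inp out : ℕ) (z v : List Bool) : Prop :=
  ∃ y t : List Bool, v = boolPair y t ∧ UChk.UGood P K m inp out (boolPair z y) t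

/-- The cost constant of `simCore`. [folklore] -/
def scConst : ℕ := 4000

/-- The registers of the checker are `30`. [folklore] -/
theorem card_UR : Fintype.card UChk.UR = 30 := rfl

/-- The size of an input store of the checker. [folklore] -/
theorem ssize_U0_le (P : UFlat.UProg) (K m inp out : ℕ) (ini tr : List Bool) :
    ssize (UChk.U0 P K m inp out ini tr).store ≤
      30 * ((UChk.encProg P).length + K + m + inp + out + ini.length + tr.length) := by
  have h : ∀ r, ((UChk.U0 P K m inp out ini tr).store r).length ≤
      (UChk.encProg P).length + K + m + inp + out + ini.length + tr.length := by
    intro r; cases r <;> simp [UChk.U0, UChk.USt.store, un] <;> omega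
  have := Finset.sum_le_card_nsmul Finset.univ (fun r => ((UChk.U0 P K m inp out ini tr).store r).length) _
    (fun r _ => h r)
  rw [Finset.card_univ, card_UR, smul_eq_mul] at this
  exact this

/-- **Effect, cost and verdict of `simCore`.** From its input store, `simCore` ends with `xr`
consumed and the verdict on `vd` (`[1]` iff `SimOK`: the word un-pairs into a witness and a
paid transcript accepted by the checker on `⟨z, y⟩`), everything else restored, within
`scConst · (size + 1)` steps. [cite: AroraBarak2009, Thm. 3.2 (proof)] -/
theorem runs_simCore (s : DSt Kf) (P : UFlat.UProg) (K m inp out : ℕ) (hinp : inp ≤ K) (hout : out ≤ K)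
    (z v : List Bool) : ∃ vd : List Bool,
      Runs simCore (scSt s P K m inp out z v).store { (scSt s P K m inp out z v) with xr := [], vd := vd }.store
        (scConst * (ssize (scSt s P K m inp out z v).store + 1)) ∧
      (vd = [] ∨ vd = [true]) ∧ (vd = [true] ↔ SimOK P K m inp out z v) := by
  -- the stores met
  let T : List Bool → List Bool → List Bool → List Bool → List Bool → List Bool → List Bool → List Bool → List Bool →
      List Bool → List Bool → List Bool → List Bool → List Bool → List Bool → DSt Kf :=
    fun xr yr bad t1 z1 z2 zz m1 m2 mm vd tr ini np flag =>
      { s with xr := xr, yr := yr, go := [], bad := bad, t1 := t1, z1 := z1, z2 := z2, m1 := m1, m2 := m2, vd := vd, zz := zz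
               mm := mm, u := { UChk.U0 P K m inp out ini tr with np := np, flag := flag } }
  have hS0 : scSt s P K m inp out z v = T v [] [] [] [] [] z [] [] (un m) [] [] [] [] [] := by simp [scSt, T, UChk.U0]
  -- sizes
  set Z := ssize (scSt s P K m inp out z v).store with hZ
  have hv : v.length ≤ Z := by
    have h := length_le_ssize (scSt s P K m inp out z v).store DReg.xr
    rwa [DSt.store_xr, show (scSt s P K m inp out z v).xr = v from rfl] at h
  have hz : z.length ≤ Z := by
    have h := length_le_ssize (scSt s P K m inp out z v).store DReg.zz
    rwa [DSt.store_zz, show (scSt s P K m inp out z v).zz = z from rfl] at h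
  have hm : m ≤ Z := by
    have h := length_le_ssize (scSt s P K m inp out z v).store DReg.mm
    rwa [DSt.store_mm, show (scSt s P K m inp out z v).mm = un m from rfl, List.length_replicate] at h
  have hK : K ≤ Z := by
    have h := length_le_ssize (scSt s P K m inp out z v).store (DReg.u .ky)
    rwa [DSt.store_u, show (scSt s P K m inp out z v).u.store .ky = un K from rfl, List.length_replicate] at h
  have hP : (UChk.encProg P).length ≤ Z := by
    have h := length_le_ssize (scSt s P K m inp out z v).store (DReg.u .code)
    rwa [DSt.store_u, show (scSt s P K m inp out z v).u.store .code = UChk.encProg P from rfl] at h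
  rw [hS0]
  rcases hu : DiagPrelims.unpair v with _ | ⟨y, trb⟩
  · -- malformed: no verdict
    obtain ⟨xr', yr', e1, hl⟩ := runs_unpairTr_none (T v [] [] [] [] [] z [] [] (un m) [] [] [] [] []) v [] [] hu
    have e1' : Runs unpairTr (T v [] [] [] [] [] z [] [] (un m) [] [] [] [] []).store
        (T xr' yr' [true] [] [] [] z [] [] (un m) [] [] [] [] []).store (1 + (8 * v.length + 7)) :=
      (e1.of_eq (by simp [T]) le_rfl).init (by simp [T])
    have f1 : Runs (clear .bad) (T xr' yr' [] [] [] [] z [] [] (un m) [] [] [] [] []).store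
        (T xr' yr' [] [] [] [] z [] [] (un m) [] [] [] [] []).store (2 * 0 + 1) :=
      (runs_clear (Γ := Bool) DReg.bad _).of_eq (by simp [T]) (by simp [T])
    have f2 : Runs (clear .xr) (T xr' yr' [] [] [] [] z [] [] (un m) [] [] [] [] []).store
        (T [] yr' [] [] [] [] z [] [] (un m) [] [] [] [] []).store (2 * xr'.length + 1) :=
      (runs_clear (Γ := Bool) DReg.xr _).of_eq (by simp [T]) (by simp [T])
    have f3 : Runs (clear .yr) (T [] yr' [] [] [] [] z [] [] (un m) [] [] [] [] []).store
        (T [] [] [] [] [] [] z [] [] (un m) [] [] [] [] []).store (2 * yr'.length + 1) :=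
      (runs_clear (Γ := Bool) DReg.yr _).of_eq (by simp [T]) (by simp [T])
    have f : Runs (pop .bad badBr) (T xr' yr' [true] [] [] [] z [] [] (un m) [] [] [] [] []).store
        (T [] [] [] [] [] [] z [] [] (un m) [] [] [] [] []).store ((2 * 0 + 1 + (2 * xr'.length + 1 + (2 * yr'.length + 1))) + 2) :=
      Runs.pop_cons' (f := badBr) (a := true) (w := []) (by simp [T]) (by simp [T]) (f1.seq (f2.seq f3))
    refine ⟨[], ?_, Or.inl rfl, ?_⟩
    · unfold simCore
      refine Runs.of_eq (e1'.seq f) (by simp [T]) ?_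
      simp only [List.length_nil] at hl; unfold scConst; omega
    · simp only [List.ne_cons_self, false_iff, SimOK]
      rintro ⟨y, t, rfl, -⟩
      rw [DiagPrelims.unpair_boolPair] at hu; cases hu
  · -- a pair word
    have hv' := DiagPrelims.eq_boolPair_of_unpair hu
    subst hv'
    have hyl : 2 * y.length + 2 + trb.length ≤ Z := by simpa using hv
    have e1 : Runs unpairTr (T (boolPair y trb) [] [] [] [] [] z [] [] (un m) [] [] [] [] []).store
        (T trb y.reverse [] [] [] [] z [] [] (un m) [] [] [] [] []).store (1 + (8 * y.length + 7)) :=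
      (runs_unpairTr (T (boolPair y trb) [] [] [] [] [] z [] [] (un m) [] [] [] [] []) y trb []).of_eq (by simp [T]) le_rfl
        |>.init (by simp [T])
    have o1 : Runs (pour .xr .t1) (T trb y.reverse [] [] [] [] z [] [] (un m) [] [] [] [] []).store
        (T [] y.reverse [] trb.reverse [] [] z [] [] (un m) [] [] [] [] []).store (3 * trb.length + 1) :=
      (runs_pour (Γ := Bool) (a := DReg.xr) (b := DReg.t1) (by simp) _).of_eq (by simp [T]) (by simp [T])
    have o2 : Runs (pour .t1 (.u .tr)) (T [] y.reverse [] trb.reverse [] [] z [] [] (un m) [] [] [] [] []).store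
        (T [] y.reverse [] [] [] [] z [] [] (un m) [] trb [] [] []).store (3 * trb.length + 1) :=
      (runs_pour (Γ := Bool) (a := DReg.t1) (b := DReg.u .tr) (by simp) _).of_eq (by simp [T, UChk.U0]) (by simp [T])
    have o3 : Runs (pour .yr (.u .ini)) (T [] y.reverse [] [] [] [] z [] [] (un m) [] trb [] [] []).store
        (T [] [] [] [] [] [] z [] [] (un m) [] trb y [] []).store (3 * y.length + 1) :=
      (runs_pour (Γ := Bool) (a := DReg.yr) (b := DReg.u .ini) (by simp) _).of_eq (by simp [T, UChk.U0]) (by simp [T])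
    have o4 : Runs (push (DReg.u .ini) true) (T [] [] [] [] [] [] z [] [] (un m) [] trb y [] []).store
        (T [] [] [] [] [] [] z [] [] (un m) [] trb (true :: y) [] []).store 1 := Runs.push' (by simp [T, UChk.U0])
    have o5 : Runs (push (DReg.u .ini) false) (T [] [] [] [] [] [] z [] [] (un m) [] trb (true :: y) [] []).store
        (T [] [] [] [] [] [] z [] [] (un m) [] trb (false :: true :: y) [] []).store 1 := Runs.push' (by simp [T, UChk.U0])
    have o6 : Runs (copy2 .zz .z1 .z2) (T [] [] [] [] [] [] z [] [] (un m) [] trb (false :: true :: y) [] []).store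
        (T [] [] [] [] z.reverse z.reverse [] [] [] (un m) [] trb (false :: true :: y) [] []).store (4 * z.length + 1) :=
      (runs_copy2 (Γ := Bool) (a := DReg.zz) (b := DReg.z1) (c := DReg.z2) (by simp) (by simp) (by simp) _).of_eq
        (by simp [T]) (by simp [T])
    have o7 : Runs (pour .z2 .zz) (T [] [] [] [] z.reverse z.reverse [] [] [] (un m) [] trb (false :: true :: y) [] []).store
        (T [] [] [] [] z.reverse [] z [] [] (un m) [] trb (false :: true :: y) [] []).store (3 * z.length + 1) :=
      (runs_pour (Γ := Bool) (a := DReg.z2) (b := DReg.zz) (by simp) _).of_eq (by simp [T]) (by simp [T])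
    have o8 : Runs iniLoop (T [] [] [] [] z.reverse [] z [] [] (un m) [] trb (false :: true :: y) [] []).store
        (T [] [] [] [] [] [] z [] [] (un m) [] trb (boolPair z y) [] []).store (4 * z.length + 1) :=
      (runs_iniLoop (T [] [] [] [] [] [] z [] [] (un m) [] trb (false :: true :: y) [] []) z (false :: true :: y)).of_eq
        (by simp [T, UChk.U0, boolPair]) le_rfl |>.init (by simp [T, UChk.U0])
    have o9 : Runs (copy2 .mm .m1 .m2) (T [] [] [] [] [] [] z [] [] (un m) [] trb (boolPair z y) [] []).store
        (T [] [] [] [] [] [] z (un m) (un m) [] [] trb (boolPair z y) [] []).store (4 * m + 1) :=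
      (runs_copy2 (Γ := Bool) (a := DReg.mm) (b := DReg.m1) (c := DReg.m2) (by simp) (by simp) (by simp) _).of_eq
        (by simp [T, un]) (by simp [T, un])
    have o10 : Runs (pour .m2 .mm) (T [] [] [] [] [] [] z (un m) (un m) [] [] trb (boolPair z y) [] []).store
        (T [] [] [] [] [] [] z (un m) [] (un m) [] trb (boolPair z y) [] []).store (3 * m + 1) :=
      (runs_pour (Γ := Bool) (a := DReg.m2) (b := DReg.mm) (by simp) _).of_eq (by simp [T, un]) (by simp [T, un])
    have o11 : Runs (pour .m1 (.u .np)) (T [] [] [] [] [] [] z (un m) [] (un m) [] trb (boolPair z y) [] []).store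
        (T [] [] [] [] [] [] z [] [] (un m) [] trb (boolPair z y) (un m) []).store (3 * m + 1) :=
      (runs_pour (Γ := Bool) (a := DReg.m1) (b := DReg.u .np) (by simp) _).of_eq (by simp [T, un, UChk.U0]) (by simp [T, un])
    -- the checker
    obtain ⟨fl, hU, hiff⟩ := UChk.runs_U P K m inp out hinp hout (boolPair z y) trb
    have hUs : ∀ i, (T [] [] [] [] [] [] z [] [] (un m) [] trb (boolPair z y) (un m) []).store (DReg.u i) =
        (UChk.U0 P K m inp out (boolPair z y) trb).store i := by intro i; simp [T, UChk.U0]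
    have o12 := hU.map (f := DReg.u) (fun a b h => by simpa using h) _ hUs
    rw [DSt.graft_u] at o12
    have o12' : Runs (UChk.U.map DReg.u) (T [] [] [] [] [] [] z [] [] (un m) [] trb (boolPair z y) (un m) []).store
        (T [] [] [] [] [] [] z [] [] (un m) [] [] (boolPair z y) [] (un fl)).store _ := o12.of_eq (by simp [T, UChk.U0]) le_rfl
    -- the size of the flag
    have hfl : fl ≤ 30 * ((UChk.encProg P).length + K + m + inp + out + (boolPair z y).length + trb.length) +
        (UChk.Uconst * ((UChk.encProg P).length + trb.length + (boolPair z y).length + m) + UChk.Uconst) := by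
      obtain ⟨t, ht, ex⟩ := hU
      have h1 := ex.ssize_le
      have h2 := length_le_ssize ({ (UChk.U0 P K m inp out (boolPair z y) trb) with tr := [], np := [], flag := un fl } :
        UChk.USt).store UChk.UR.flag
      have e : ({ (UChk.U0 P K m inp out (boolPair z y) trb) with tr := [], np := [], flag := un fl } : UChk.USt).store
          UChk.UR.flag = un fl := rfl
      rw [e, List.length_replicate] at h2
      have h3 := ssize_U0_le P K m inp out (boolPair z y) trb
      omega
    have o13 : Runs (clear (.u .ini)) (T [] [] [] [] [] [] z [] [] (un m) [] [] (boolPair z y) [] (un fl)).store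
        (T [] [] [] [] [] [] z [] [] (un m) [] [] [] [] (un fl)).store (2 * (boolPair z y).length + 1) :=
      (runs_clear (Γ := Bool) (DReg.u .ini) _).of_eq (by simp [T, UChk.U0]) (by simp [T, UChk.U0])
    -- the verdict
    have o14 : ∃ vd : List Bool, Runs (pop (.u .flag) flagBr) (T [] [] [] [] [] [] z [] [] (un m) [] [] [] [] (un fl)).store
        (T [] [] [] [] [] [] z [] [] (un m) vd [] [] [] []).store (2 * fl + 3) ∧ (vd = [] ∨ vd = [true]) ∧ (vd = [true] ↔ fl = 0) := by
      rcases fl with _ | f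
      · refine ⟨[true], ?_, Or.inr rfl, by simp⟩
        exact (Runs.pop_nil (by simp [T, UChk.U0, un]) (Runs.push' (R' := (T [] [] [] [] [] [] z [] [] (un m) [true] [] [] [] []).store)
          (by simp [T]))).mono (by omega)
      · refine ⟨[], ?_, Or.inl rfl, by simp⟩
        have c : Runs (clear (DReg.u .flag)) (T [] [] [] [] [] [] z [] [] (un m) [] [] [] [] (un f)).store
            (T [] [] [] [] [] [] z [] [] (un m) [] [] [] [] []).store (2 * f + 1) :=
          (runs_clear (Γ := Bool) (DReg.u .flag) _).of_eq (by simp [T, UChk.U0, un]) (by simp [T, UChk.U0, un])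
        exact (Runs.pop_cons' (f := flagBr) (a := true) (w := un f) (by simp [T, UChk.U0, un, List.replicate_succ])
          (by simp [T, UChk.U0]) c).mono (by omega)
    obtain ⟨vd, o14, hvd, hvd'⟩ := o14
    have ok : Runs okB (T trb y.reverse [] [] [] [] z [] [] (un m) [] [] [] [] []).store
        (T [] [] [] [] [] [] z [] [] (un m) vd [] [] [] []).store _ :=
      o1.seq (o2.seq (o3.seq (o4.seq (o5.seq (o6.seq (o7.seq (o8.seq (o9.seq (o10.seq (o11.seq (o12'.seq
        (o13.seq o14))))))))))))
    have f : Runs (pop .bad badBr) (T trb y.reverse [] [] [] [] z [] [] (un m) [] [] [] [] []).store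
        (T [] [] [] [] [] [] z [] [] (un m) vd [] [] [] []).store _ := Runs.pop_nil (by simp [T]) ok
    refine ⟨vd, ?_, hvd, ?_⟩
    · unfold simCore
      refine Runs.of_eq (e1.seq f) (by simp [T]) ?_
      have hio : inp + out ≤ 2 * Z := by omega
      simp only [length_boolPair] at hfl ⊢
      unfold scConst UChk.Uconst at *
      omega
    · rw [hvd', hiff, SimOK]
      constructor
      · intro h; exact ⟨y, trb, rfl, h⟩
      · rintro ⟨y', t', he, h⟩
        have := DiagPrelims.unpair_boolPair y' t'
        rw [← he, DiagPrelims.unpair_boolPair] at this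
        simp only [Option.some.injEq, Prod.mk.injEq] at this
        obtain ⟨rfl, rfl⟩ := this
        exact h

/-! ### The binary counter -/

/-- The successor of an all-ones word. [folklore] -/
theorem bsucc_ones (k : ℕ) : DiagPrelims.bsucc (un k) = List.replicate (k + 1) false := by
  have h : DiagPrelims.allOnes (un k) := fun b hb => List.eq_of_mem_replicate hb
  simp [DiagPrelims.bsucc, h, un]

/-- Incrementing ones followed by a zero. [folklore] -/
theorem binc_ones_false (k : ℕ) (v : List Bool) :
    DiagPrelims.binc (un k ++ false :: v) = List.replicate k false ++ true :: v := by
  induction k with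
  | zero => rfl
  | succ k ih => simp [un, List.replicate_succ, DiagPrelims.binc] at ih ⊢; exact ih

/-- The successor of ones followed by a zero. [folklore] -/
theorem bsucc_ones_false (k : ℕ) (v : List Bool) :
    DiagPrelims.bsucc (un k ++ false :: v) = List.replicate k false ++ true :: v := by
  rw [DiagPrelims.bsucc, if_neg (fun h => by simpa using h false (by simp)), binc_ones_false]

/-- The branches of the counter loop: a `1` is carried (as a `0` on `tmp`), a `0` becomes `1`
and the carried zeros return, an exhausted word grows by one (all zeros) and `grew` is raised.
[folklore] -/
def bsBr : Option Bool → Prog Kf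
  | some true => push .tmp false ;; push .go true
  | some false => push .cur true ;; pour .tmp .cur
  | none => push .cur false ;; pour .tmp .cur ;; push .grew true

/-- **`bsuccP`**: `cur := bsucc cur`, raising `grew` if the length grew. [folklore] -/
def bsuccP : Prog Kf := push .go true ;; loop .go fun _ => pop .cur bsBr

/-- Whether the word grew, as a register content. [folklore] -/
def grewOf (v : List Bool) : List Bool := if DiagPrelims.allOnes v then [true] else []

/-- The loop of `bsuccP`, `k` ones already carried. [folklore] -/
theorem runs_bsuccLoop (s : DSt Kf) : ∀ (v : List Bool) (k : ℕ), ∃ B : ℕ,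
    Runs (loop .go fun _ => pop .cur bsBr) { s with cur := v, tmp := List.replicate k false, go := [true], grew := [] }.store
      { s with cur := DiagPrelims.bsucc (un k ++ v), tmp := [], go := [], grew := grewOf (un k ++ v) }.store B
  | [], k => by
    let T : List Bool → List Bool → List Bool → List Bool → DSt Kf := fun c t g gr =>
      { s with cur := c, tmp := t, go := g, grew := gr }
    have p1 : Runs (push DReg.cur false) (T [] (List.replicate k false) [] []).store
        (T [false] (List.replicate k false) [] []).store 1 := Runs.push' (by simp [T])
    have p2 : Runs (pour .tmp .cur) (T [false] (List.replicate k false) [] []).store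
        (T (List.replicate (k + 1) false) [] [] []).store (3 * k + 1) :=
      (runs_pour (Γ := Bool) (a := DReg.tmp) (b := DReg.cur) (by simp) _).of_eq
        (by simp [T, List.replicate_succ']) (by simp [T])
    have p3 : Runs (push DReg.grew true) (T (List.replicate (k + 1) false) [] [] []).store
        (T (List.replicate (k + 1) false) [] [] [true]).store 1 := Runs.push' (by simp [T])
    have e : Runs (pop .cur bsBr) (T [] (List.replicate k false) [] []).store (T (List.replicate (k + 1) false) [] [] [true]).store
        _ := Runs.pop_nil (by simp [T]) (p1.seq (p2.seq p3))
    have h := Runs.loop_cons (k := DReg.go) (f := fun _ => pop .cur bsBr) (R := (T [] (List.replicate k false) [true] []).store)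
      (a := true) (w := []) (by simp [T]) (e.init (by simp [T])) (Runs.loop_nil _ (by simp [T]))
    refine ⟨_, h.of_eq ?_ le_rfl⟩
    simp [T, grewOf, bsucc_ones, DiagPrelims.allOnes, un]
  | true :: v, k => by
    let T : List Bool → List Bool → List Bool → List Bool → DSt Kf := fun c t g gr =>
      { s with cur := c, tmp := t, go := g, grew := gr }
    have p1 : Runs (push DReg.tmp false) (T v (List.replicate k false) [] []).store
        (T v (List.replicate (k + 1) false) [] []).store 1 := Runs.push' (by simp [T, List.replicate_succ])
    have p2 : Runs (push DReg.go true) (T v (List.replicate (k + 1) false) [] []).store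
        (T v (List.replicate (k + 1) false) [true] []).store 1 := Runs.push' (by simp [T])
    have e : Runs (pop .cur bsBr) (T (true :: v) (List.replicate k false) [] []).store
        (T v (List.replicate (k + 1) false) [true] []).store _ :=
      Runs.pop_cons' (f := bsBr) (a := true) (w := v) (by simp [T]) (by simp [T]) (p1.seq p2)
    obtain ⟨B, ih⟩ := runs_bsuccLoop s v (k + 1)
    have h := Runs.loop_cons (k := DReg.go) (f := fun _ => pop .cur bsBr) (R := (T (true :: v) (List.replicate k false) [true] []).store)
      (a := true) (w := []) (by simp [T]) (e.init (by simp [T])) ih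
    refine ⟨_, h.of_eq ?_ le_rfl⟩
    have : un (k + 1) ++ v = un k ++ true :: v := by simp [un, List.replicate_succ']
    rw [this]
  | false :: v, k => by
    let T : List Bool → List Bool → List Bool → List Bool → DSt Kf := fun c t g gr =>
      { s with cur := c, tmp := t, go := g, grew := gr }
    have p1 : Runs (push DReg.cur true) (T v (List.replicate k false) [] []).store
        (T (true :: v) (List.replicate k false) [] []).store 1 := Runs.push' (by simp [T])
    have p2 : Runs (pour .tmp .cur) (T (true :: v) (List.replicate k false) [] []).store
        (T (List.replicate k false ++ true :: v) [] [] []).store (3 * k + 1) :=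
      (runs_pour (Γ := Bool) (a := DReg.tmp) (b := DReg.cur) (by simp) _).of_eq (by simp [T]) (by simp [T])
    have e : Runs (pop .cur bsBr) (T (false :: v) (List.replicate k false) [] []).store
        (T (List.replicate k false ++ true :: v) [] [] []).store _ :=
      Runs.pop_cons' (f := bsBr) (a := false) (w := v) (by simp [T]) (by simp [T]) (p1.seq p2)
    have h := Runs.loop_cons (k := DReg.go) (f := fun _ => pop .cur bsBr) (R := (T (false :: v) (List.replicate k false) [true] []).store)
      (a := true) (w := []) (by simp [T]) (e.init (by simp [T])) (Runs.loop_nil _ (by simp [T]))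
    refine ⟨_, h.of_eq ?_ le_rfl⟩
    have hno : ¬ DiagPrelims.allOnes (un k ++ false :: v) := fun h' => by simpa using h' false (by simp)
    simp [T, grewOf, bsucc_ones_false, hno]

/-- **Effect of `bsuccP`.** [folklore] -/
theorem runs_bsuccP (s : DSt Kf) (v : List Bool) : ∃ B : ℕ,
    Runs bsuccP { s with cur := v, tmp := [], go := [], grew := [] }.store
      { s with cur := DiagPrelims.bsucc v, tmp := [], go := [], grew := grewOf v }.store B := by
  obtain ⟨B, h⟩ := runs_bsuccLoop s v 0
  refine ⟨1 + B, ?_⟩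
  unfold bsuccP
  have h' : Runs (loop .go fun _ => pop .cur bsBr) ({ s with cur := v, tmp := [], go := [true], grew := [] } : DSt Kf).store
      ({ s with cur := DiagPrelims.bsucc v, tmp := [], go := [], grew := grewOf v } : DSt Kf).store B :=
    (h.of_eq (by simp [un]) le_rfl).init (by simp)
  exact (Runs.push' (by simp)).seq h'

/-! ### Unary multiplication -/

/-- **`mulP`**: `nn += |e2| · |xr|` (consuming `e2`, keeping `xr`). [folklore] -/
def mulP : Prog Kf := loop .e2 fun _ => copy2 .xr .t1 .t2 ;; pour .t1 .xr ;; pour .t2 .nn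

/-- **Effect of `mulP`.** [folklore] -/
theorem runs_mulP (s : DSt Kf) (F : ℕ) : ∀ (E : ℕ) (acc : List Bool), ∃ B : ℕ,
    Runs mulP { s with e2 := un E, xr := un F, t1 := [], t2 := [], nn := acc }.store
      { s with e2 := [], xr := un F, t1 := [], t2 := [], nn := un (E * F) ++ acc }.store B
  | 0, acc => ⟨1, (Runs.loop_nil _ (by simp)).of_eq (by simp [un]) le_rfl⟩
  | E + 1, acc => by
    let T : List Bool → List Bool → List Bool → List Bool → List Bool → DSt Kf := fun e x t1 t2 n =>
      { s with e2 := e, xr := x, t1 := t1, t2 := t2, nn := n }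
    have c1 : Runs (copy2 .xr .t1 .t2) (T (un E) (un F) [] [] acc).store (T (un E) [] (un F) (un F) acc).store (4 * F + 1) :=
      (runs_copy2 (Γ := Bool) (a := DReg.xr) (b := DReg.t1) (c := DReg.t2) (by simp) (by simp) (by simp) _).of_eq
        (by simp [T, un]) (by simp [T, un])
    have c2 : Runs (pour .t1 .xr) (T (un E) [] (un F) (un F) acc).store (T (un E) (un F) [] (un F) acc).store (3 * F + 1) :=
      (runs_pour (Γ := Bool) (a := DReg.t1) (b := DReg.xr) (by simp) _).of_eq (by simp [T, un]) (by simp [T, un])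
    have c3 : Runs (pour .t2 .nn) (T (un E) (un F) [] (un F) acc).store (T (un E) (un F) [] [] (un F ++ acc)).store (3 * F + 1) :=
      (runs_pour (Γ := Bool) (a := DReg.t2) (b := DReg.nn) (by simp) _).of_eq (by simp [T, un]) (by simp [T, un])
    obtain ⟨B, ih⟩ := runs_mulP s F E (un F ++ acc)
    have h := Runs.loop_cons (k := DReg.e2) (f := fun _ => copy2 .xr .t1 .t2 ;; pour .t1 .xr ;; pour .t2 .nn)
      (R := (T (un (E + 1)) (un F) [] [] acc).store) (a := true) (w := un E) (by simp [T, un, List.replicate_succ])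
      ((c1.seq (c2.seq c3)).init (by simp [T])) (ih.init (by simp [T]))
    refine ⟨_, h.of_eq ?_ le_rfl⟩
    simp [un, Nat.succ_mul, ← List.append_assoc]

/-! ### The exhaustive search -/

/-- A positive verdict is OR-ed into `res`. [folklore] -/
def vdBr : Option Bool → Prog Kf
  | some _ => clear .res ;; push .res true
  | none => skip

/-- After a growth of the counter: one level less, or stop. [folklore] -/
def nnBr : Option Bool → Prog Kf
  | some _ => push .go2 true
  | none => skip

/-- Dispatch on `grew`. [folklore] -/
def grewBr : Option Bool → Prog Kf
  | some _ => pop .nn nnBr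
  | none => push .go2 true

/-- The body of the search loop: check the current word, OR the verdict, step the counter.
[folklore] -/
def srchBody : Prog Kf :=
  copy2 .cur .c1 .c2 ;; pour .c1 .cur ;; pour .c2 .xr ;; simCore ;; pop .vd vdBr ;; bsuccP ;; pop .grew grewBr

/-- The search loop. [folklore] -/
def srchLoop : Prog Kf := loop .go2 fun _ => srchBody

/-- The state of the search loop: current word `v`, `n` levels left, result `r`, loop token.
[folklore] -/
def srchSt (s : DSt Kf) (P : UFlat.UProg) (K m inp out : ℕ) (z v : List Bool) (n : ℕ) (r g2 : List Bool) : DSt Kf :=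
  { (scSt s P K m inp out z []) with cur := v, nn := un n, res := r, go2 := g2, c1 := [], c2 := [], tmp := [], grew := [] }

/-- OR-ing a verdict. [folklore] -/
def orV (r : List Bool) (p : Prop) [Decidable p] : List Bool := if p then [true] else r

/-- **One round of the search loop body.** [folklore] -/
theorem runs_srchBody (s : DSt Kf) (P : UFlat.UProg) (K m inp out : ℕ) (hinp : inp ≤ K) (hout : out ≤ K)
    (z v : List Bool) (n : ℕ) (r : List Bool) : ∃ (B : ℕ) (r₁ : List Bool) (n₁ : ℕ) (g : List Bool),
      Runs srchBody (srchSt s P K m inp out z v n r []).store (srchSt s P K m inp out z (DiagPrelims.bsucc v) n₁ r₁ g).store B ∧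
      (r₁ = [true] ↔ (r = [true] ∨ SimOK P K m inp out z v)) ∧ (r₁ = [] ∨ r₁ = [true] ∨ r₁ = r) ∧
      ((¬ DiagPrelims.allOnes v ∧ n₁ = n ∧ g = [true]) ∨ (DiagPrelims.allOnes v ∧ n = n₁ + 1 ∧ g = [true]) ∨
        (DiagPrelims.allOnes v ∧ n = 0 ∧ n₁ = 0 ∧ g = [])) := by
  classical
  -- the stores met: `T xr cur c1 c2 vd res nn go2 grew`
  let T : List Bool → List Bool → List Bool → List Bool → List Bool → List Bool → List Bool → List Bool → List Bool →
      DSt Kf := fun xr cur c1 c2 vd res nn go2 grew =>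
    { (scSt s P K m inp out z xr) with cur := cur, nn := nn, res := res, go2 := go2, c1 := c1, c2 := c2, tmp := [], grew := grew
                                       vd := vd }
  have hT0 : srchSt s P K m inp out z v n r [] = T [] v [] [] [] r (un n) [] [] := by simp [srchSt, T, scSt]
  have b1 : Runs (copy2 .cur .c1 .c2) (T [] v [] [] [] r (un n) [] []).store (T [] [] v.reverse v.reverse [] r (un n) [] []).store
      (4 * v.length + 1) :=
    (runs_copy2 (Γ := Bool) (a := DReg.cur) (b := DReg.c1) (c := DReg.c2) (by simp) (by simp) (by simp) _).of_eq
      (by simp [T, scSt]) (by simp [T, scSt])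
  have b2 : Runs (pour .c1 .cur) (T [] [] v.reverse v.reverse [] r (un n) [] []).store
      (T [] v [] v.reverse [] r (un n) [] []).store (3 * v.length + 1) :=
    (runs_pour (Γ := Bool) (a := DReg.c1) (b := DReg.cur) (by simp) _).of_eq (by simp [T, scSt]) (by simp [T, scSt])
  have b3 : Runs (pour .c2 .xr) (T [] v [] v.reverse [] r (un n) [] []).store
      (T v v [] [] [] r (un n) [] []).store (3 * v.length + 1) :=
    (runs_pour (Γ := Bool) (a := DReg.c2) (b := DReg.xr) (by simp) _).of_eq (by simp [T, scSt]) (by simp [T, scSt])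
  -- the check
  obtain ⟨vd, b4, hvd, hvd'⟩ :=
    runs_simCore ({ s with cur := v, nn := un n, res := r, go2 := [], c1 := [], c2 := [], tmp := [], grew := [] } : DSt Kf)
      P K m inp out hinp hout z v
  have b4' : Runs simCore (T v v [] [] [] r (un n) [] []).store (T [] v [] [] vd r (un n) [] []).store _ :=
    (b4.of_eq (by simp [T, scSt]) le_rfl).init (by simp [T, scSt])
  -- OR-ing the verdict
  have b5 : ∃ B, Runs (pop .vd vdBr) (T [] v [] [] vd r (un n) [] []).store
      (T [] v [] [] [] (orV r (vd = [true])) (un n) [] []).store B := by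
    rcases hvd with rfl | rfl
    · exact ⟨_, Runs.pop_nil (by simp [T, scSt]) ((Runs.skip _).of_eq (by simp [T, orV]) le_rfl)⟩
    · have c : Runs (clear .res) (T [] v [] [] [] r (un n) [] []).store (T [] v [] [] [] [] (un n) [] []).store (2 * r.length + 1) :=
        (runs_clear (Γ := Bool) DReg.res _).of_eq (by simp [T, scSt]) (by simp [T, scSt])
      have p : Runs (push DReg.res true) (T [] v [] [] [] [] (un n) [] []).store (T [] v [] [] [] [true] (un n) [] []).store 1 :=
        Runs.push' (by simp [T, scSt])
      exact ⟨_, Runs.pop_cons' (f := vdBr) (a := true) (w := []) (by simp [T, scSt]) (by simp [T, scSt])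
        ((c.seq p).of_eq (by simp [orV]) le_rfl)⟩
  obtain ⟨B5, b5⟩ := b5
  set r₁ := orV r (vd = [true]) with hr₁
  -- the counter
  obtain ⟨B6, b6⟩ := runs_bsuccP (T [] v [] [] [] r₁ (un n) [] []) v
  have b6' : Runs bsuccP (T [] v [] [] [] r₁ (un n) [] []).store (T [] (DiagPrelims.bsucc v) [] [] [] r₁ (un n) [] (grewOf v)).store B6 :=
    (b6.of_eq (by simp [T, scSt]) le_rfl).init (by simp [T, scSt])
  -- the level bookkeeping
  have b7 : ∃ (B : ℕ) (n₁ : ℕ) (g : List Bool),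
      Runs (pop .grew grewBr) (T [] (DiagPrelims.bsucc v) [] [] [] r₁ (un n) [] (grewOf v)).store
        (T [] (DiagPrelims.bsucc v) [] [] [] r₁ (un n₁) g []).store B ∧
      ((¬ DiagPrelims.allOnes v ∧ n₁ = n ∧ g = [true]) ∨ (DiagPrelims.allOnes v ∧ n = n₁ + 1 ∧ g = [true]) ∨
        (DiagPrelims.allOnes v ∧ n = 0 ∧ n₁ = 0 ∧ g = [])) := by
    let bv := DiagPrelims.bsucc v
    by_cases ha : DiagPrelims.allOnes v
    · have hg : grewOf v = [true] := by simp [grewOf, ha]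
      rw [hg]
      rcases n with _ | n₁
      · have q2 : Runs (grewBr (some true)) (T [] bv [] [] [] r₁ (un 0) [] []).store (T [] bv [] [] [] r₁ (un 0) [] []).store
            (0 + 2) := Runs.pop_nil (by simp [T, scSt, un]) (Runs.skip _)
        have q1 : Runs (pop .grew grewBr) (T [] bv [] [] [] r₁ (un 0) [] [true]).store (T [] bv [] [] [] r₁ (un 0) [] []).store
            (0 + 2 + 2) := Runs.pop_cons' (f := grewBr) (a := true) (w := []) (by simp [T, scSt]) (by simp [T, scSt]) q2
        exact ⟨_, 0, [], q1, Or.inr (Or.inr ⟨ha, rfl, rfl, rfl⟩)⟩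
      · have q3 : Runs (nnBr (some true)) (T [] bv [] [] [] r₁ (un n₁) [] []).store (T [] bv [] [] [] r₁ (un n₁) [true] []).store 1 :=
          Runs.push' (by simp [T, scSt])
        have q2 : Runs (grewBr (some true)) (T [] bv [] [] [] r₁ (un (n₁ + 1)) [] []).store
            (T [] bv [] [] [] r₁ (un n₁) [true] []).store (1 + 2) :=
          Runs.pop_cons' (f := nnBr) (a := true) (w := un n₁) (by simp [T, scSt, un, List.replicate_succ]) (by simp [T, scSt]) q3
        have q1 : Runs (pop .grew grewBr) (T [] bv [] [] [] r₁ (un (n₁ + 1)) [] [true]).store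
            (T [] bv [] [] [] r₁ (un n₁) [true] []).store (1 + 2 + 2) :=
          Runs.pop_cons' (f := grewBr) (a := true) (w := []) (by simp [T, scSt]) (by simp [T, scSt]) q2
        exact ⟨_, n₁, [true], q1, Or.inr (Or.inl ⟨ha, rfl, rfl⟩)⟩
    · have hg : grewOf v = [] := by simp [grewOf, ha]
      rw [hg]
      have q2 : Runs (grewBr none) (T [] bv [] [] [] r₁ (un n) [] []).store (T [] bv [] [] [] r₁ (un n) [true] []).store 1 :=
        Runs.push' (by simp [T, scSt])
      exact ⟨_, n, [true], Runs.pop_nil (by simp [T, scSt]) q2, Or.inl ⟨ha, rfl, rfl⟩⟩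
  obtain ⟨B7, n₁, g, b7, hcase⟩ := b7
  have main := b1.seq (b2.seq (b3.seq (b4'.seq (b5.seq (b6'.seq b7)))))
  have h2 : r₁ = [true] ↔ (r = [true] ∨ SimOK P K m inp out z v) := by
    rw [hr₁, orV]
    split_ifs with h
    · simp [hvd'.1 h]
    · have : ¬ SimOK P K m inp out z v := fun h' => h (hvd'.2 h')
      simp [this]
  have h3 : r₁ = [] ∨ r₁ = [true] ∨ r₁ = r := by rw [hr₁, orV]; split_ifs <;> simp
  exact ⟨_, r₁, n₁, g, by
    rw [hT0]; unfold srchBody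
    exact main.of_eq (by simp [srchSt, T, scSt]) le_rfl, h2, h3, hcase⟩

/-- The length of the successor. [folklore] -/
theorem length_bsucc (v : List Bool) :
    (DiagPrelims.bsucc v).length = if DiagPrelims.allOnes v then v.length + 1 else v.length := by
  unfold DiagPrelims.bsucc; split_ifs <;> simp

/-- **The search loop** from word `v` with the right number of levels visits every word from `v`
on of length `≤ N`, OR-ing the verdicts into `res`. [folklore] -/
theorem runs_srchLoop (s : DSt Kf) (P : UFlat.UProg) (K m inp out : ℕ) (hinp : inp ≤ K) (hout : out ≤ K)
    (z : List Bool) (N : ℕ) : ∀ (μ : ℕ) (v r : List Bool), μ = 2 ^ (N + 1) - DiagPrelims.brank v → v.length ≤ N →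
    ∃ (B : ℕ) (cur' r' : List Bool),
      Runs srchLoop (srchSt s P K m inp out z v (N - v.length) r [true]).store (srchSt s P K m inp out z cur' 0 r' []).store B ∧
      (r' = [true] ↔ (r = [true] ∨ ∃ v', DiagPrelims.brank v ≤ DiagPrelims.brank v' ∧ v'.length ≤ N ∧ SimOK P K m inp out z v')) ∧
      (r' = [] ∨ r' = [true] ∨ r' = r) := by
  intro μ
  induction μ using Nat.strong_induction_on with
  | _ μ ih =>
  intro v r hμ hv
  obtain ⟨B, r₁, n₁, g, hb, h1, h2, hcase⟩ := runs_srchBody s P K m inp out hinp hout z v (N - v.length) r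
  have hbr := DiagPrelims.brank_bsucc v
  have hvr := (DiagPrelims.brank_lt_iff v N).2 hv
  -- one iteration of the loop from the token state
  have ITER : ∀ {R₂ : AStore Bool (DReg Kf)} {B₂ : ℕ},
      Runs srchLoop (srchSt s P K m inp out z (DiagPrelims.bsucc v) n₁ r₁ g).store R₂ B₂ →
      Runs srchLoop (srchSt s P K m inp out z v (N - v.length) r [true]).store R₂ (B + 2 + B₂) := fun h₂ =>
    Runs.loop_cons (k := DReg.go2) (f := fun _ => srchBody) (a := true) (w := []) (by simp [srchSt, scSt])
      (hb.init (by simp [srchSt, scSt])) h₂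
  rcases hcase with ⟨ha, rfl, rfl⟩ | ⟨ha, hn, rfl⟩ | ⟨ha, hn, rfl, rfl⟩
  · -- no growth: continue at the same level
    have hl : (DiagPrelims.bsucc v).length = v.length := by rw [length_bsucc, if_neg ha]
    have hv' : (DiagPrelims.bsucc v).length ≤ N := by omega
    have hvr' := (DiagPrelims.brank_lt_iff _ N).2 hv'
    obtain ⟨B₂, cur', r', h₂, h₂1, h₂2⟩ := ih (2 ^ (N + 1) - DiagPrelims.brank (DiagPrelims.bsucc v)) (by omega)
      (DiagPrelims.bsucc v) r₁ rfl hv'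
    rw [hl] at h₂
    refine ⟨_, cur', r', ITER h₂, ?_, ?_⟩
    · rw [h₂1, h1]
      constructor
      · rintro ((h | h) | ⟨v', hv1, hv2, hv3⟩)
        · exact Or.inl h
        · exact Or.inr ⟨v, le_rfl, hv, h⟩
        · exact Or.inr ⟨v', by omega, hv2, hv3⟩
      · rintro (h | ⟨v', hv1, hv2, hv3⟩)
        · exact Or.inl (Or.inl h)
        · rcases Nat.eq_or_lt_of_le hv1 with he | hlt
          · rw [DiagPrelims.brank_injective he.symm] at hv3; exact Or.inl (Or.inr hv3)
          · exact Or.inr ⟨v', by omega, hv2, hv3⟩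
    · rcases h₂2 with h | h | rfl
      · exact Or.inl h
      · exact Or.inr (Or.inl h)
      · exact h2
  · -- growth with a level left: continue one level down
    have hl : (DiagPrelims.bsucc v).length = v.length + 1 := by rw [length_bsucc, if_pos ha]
    have hv' : (DiagPrelims.bsucc v).length ≤ N := by omega
    have hvr' := (DiagPrelims.brank_lt_iff _ N).2 hv'
    obtain ⟨B₂, cur', r', h₂, h₂1, h₂2⟩ := ih (2 ^ (N + 1) - DiagPrelims.brank (DiagPrelims.bsucc v)) (by omega)
      (DiagPrelims.bsucc v) r₁ rfl hv'
    rw [hl, show N - (v.length + 1) = n₁ by omega] at h₂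
    refine ⟨_, cur', r', ITER h₂, ?_, ?_⟩
    · rw [h₂1, h1]
      constructor
      · rintro ((h | h) | ⟨v', hv1, hv2, hv3⟩)
        · exact Or.inl h
        · exact Or.inr ⟨v, le_rfl, hv, h⟩
        · exact Or.inr ⟨v', by omega, hv2, hv3⟩
      · rintro (h | ⟨v', hv1, hv2, hv3⟩)
        · exact Or.inl (Or.inl h)
        · rcases Nat.eq_or_lt_of_le hv1 with he | hlt
          · rw [DiagPrelims.brank_injective he.symm] at hv3; exact Or.inl (Or.inr hv3)
          · exact Or.inr ⟨v', by omega, hv2, hv3⟩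
    · rcases h₂2 with h | h | rfl
      · exact Or.inl h
      · exact Or.inr (Or.inl h)
      · exact h2
  · -- growth without a level left: the last word of length `N`, stop
    have hl : (DiagPrelims.bsucc v).length = v.length + 1 := by rw [length_bsucc, if_pos ha]
    have hvN : v.length = N := by omega
    have hlow := (DiagPrelims.brank_bounds (DiagPrelims.bsucc v)).1
    rw [hl, hvN, hbr] at hlow
    rw [hn] at ITER ⊢
    refine ⟨_, DiagPrelims.bsucc v, r₁, ITER (Runs.loop_nil _ (by simp [srchSt, scSt])), ?_, h2⟩
    rw [h1]
    constructor
    · rintro (h | h)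
      · exact Or.inl h
      · exact Or.inr ⟨v, le_rfl, hv, h⟩
    · rintro (h | ⟨v', hv1, hv2, hv3⟩)
      · exact Or.inl h
      · have hlt := (DiagPrelims.brank_lt_iff v' N).2 hv2
        have he : DiagPrelims.brank v' = DiagPrelims.brank v := by omega
        rw [DiagPrelims.brank_injective he] at hv3
        exact Or.inr hv3

/-- The preparation of the search: the clock value `1^{F₀}` is read off the clock program's
output `⟨1^M, 1^{F₀}⟩` on register `outf`, and the number of levels `N = E · F₀` is computed.
[folklore] -/
def srchInit (outf : Fin Kf) : Prog Kf :=
  pour (.pf outf) .t1 ;; pour .t1 .xr ;; unpairTr ;; clear .yr ;; copy2 .ee .e1 .e2 ;; pour .e1 .ee ;; mulP ;; clear .xr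

/-- **The exhaustive search.** [folklore] -/
def search (outf : Fin Kf) : Prog Kf := srchInit outf ;; push .go2 true ;; srchLoop

/-- The base store of the search (after the preparation). [folklore] -/
def srchBase (s : DSt Kf) (E : ℕ) : DSt Kf := { s with pf := fun _ => [], ee := un E, e1 := [], e2 := [], t2 := [] }

/-- The input store of the search. [folklore] -/
def srch0 (s : DSt Kf) (P : UFlat.UProg) (K m inp out : ℕ) (z : List Bool) (E M F₀ : ℕ) (outf : Fin Kf) : DSt Kf :=
  { (srchSt (srchBase s E) P K m inp out z [] 0 [] []) with pf := update (fun _ => []) outf (boolPair (un M) (un F₀)) }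

/-- **Effect of the exhaustive search**: `res = [1]` iff some word of length `≤ E · F₀` passes
`simCore`. [cite: AroraBarak2009, Thm. 3.2 (proof)] -/
theorem runs_search (s : DSt Kf) (P : UFlat.UProg) (K m inp out : ℕ) (hinp : inp ≤ K) (hout : out ≤ K) (z : List Bool)
    (E M F₀ : ℕ) (outf : Fin Kf) : ∃ (B : ℕ) (cur' r' : List Bool),
      Runs (search outf) (srch0 s P K m inp out z E M F₀ outf).store
        (srchSt (srchBase s E) P K m inp out z cur' 0 r' []).store B ∧
      (r' = [true] ↔ ∃ v, v.length ≤ E * F₀ ∧ SimOK P K m inp out z v) ∧ (r' = [] ∨ r' = [true]) := by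
  -- the stores met during the preparation: `T pf t1 xr yr ee e1 e2 nn go2`
  let s' := srchBase s E
  let T : (Fin Kf → List Bool) → List Bool → List Bool → List Bool → List Bool → List Bool → List Bool → List Bool →
      List Bool → DSt Kf := fun pf t1 xr yr ee e1 e2 nn go2 =>
    { (srchSt s' P K m inp out z [] 0 [] go2) with pf := pf, t1 := t1, xr := xr, yr := yr, ee := ee, e1 := e1, e2 := e2, nn := nn }
  have hT0 : srch0 s P K m inp out z E M F₀ outf = T (update (fun _ => []) outf (boolPair (un M) (un F₀))) [] [] [] (un E) [] [] [] [] := by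
    simp [srch0, T, srchSt, scSt, s', srchBase, un]
  have i1 : Runs (pour (.pf outf) .t1) (T (update (fun _ => []) outf (boolPair (un M) (un F₀))) [] [] [] (un E) [] [] [] []).store
      (T (fun _ => []) (boolPair (un M) (un F₀)).reverse [] [] (un E) [] [] [] []).store (3 * (boolPair (un M) (un F₀)).length + 1) := by
    refine (runs_pour (Γ := Bool) (a := DReg.pf outf) (b := DReg.t1) (by simp) _).of_eq ?_ (by simp [T, srchSt, scSt])
    simp only [DSt.store_pf, DSt.store_t1, DSt.update_store_pf, DSt.update_store_t1, T, srchSt, scSt]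
    congr 1; simp
  have i2 : Runs (pour .t1 .xr) (T (fun _ => []) (boolPair (un M) (un F₀)).reverse [] [] (un E) [] [] [] []).store
      (T (fun _ => []) [] (boolPair (un M) (un F₀)) [] (un E) [] [] [] []).store (3 * (boolPair (un M) (un F₀)).length + 1) :=
    (runs_pour (Γ := Bool) (a := DReg.t1) (b := DReg.xr) (by simp) _).of_eq (by simp [T, srchSt, scSt]) (by simp [T, srchSt, scSt])
  have i3 : Runs unpairTr (T (fun _ => []) [] (boolPair (un M) (un F₀)) [] (un E) [] [] [] []).store
      (T (fun _ => []) [] (un F₀) (un M) (un E) [] [] [] []).store (1 + (8 * (un M).length + 7)) :=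
    (runs_unpairTr (T (fun _ => []) [] (boolPair (un M) (un F₀)) [] (un E) [] [] [] []) (un M) (un F₀) []).of_eq
      (by simp [T, srchSt, scSt, un]) le_rfl |>.init (by simp [T, srchSt, scSt])
  have i4 : Runs (clear .yr) (T (fun _ => []) [] (un F₀) (un M) (un E) [] [] [] []).store
      (T (fun _ => []) [] (un F₀) [] (un E) [] [] [] []).store (2 * M + 1) :=
    (runs_clear (Γ := Bool) DReg.yr _).of_eq (by simp [T, srchSt, scSt]) (by simp [T, srchSt, scSt, un])
  have i5 : Runs (copy2 .ee .e1 .e2) (T (fun _ => []) [] (un F₀) [] (un E) [] [] [] []).store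
      (T (fun _ => []) [] (un F₀) [] [] (un E) (un E) [] []).store (4 * E + 1) :=
    (runs_copy2 (Γ := Bool) (a := DReg.ee) (b := DReg.e1) (c := DReg.e2) (by simp) (by simp) (by simp) _).of_eq
      (by simp [T, srchSt, scSt, un]) (by simp [T, srchSt, scSt, un])
  have i6 : Runs (pour .e1 .ee) (T (fun _ => []) [] (un F₀) [] [] (un E) (un E) [] []).store
      (T (fun _ => []) [] (un F₀) [] (un E) [] (un E) [] []).store (3 * E + 1) :=
    (runs_pour (Γ := Bool) (a := DReg.e1) (b := DReg.ee) (by simp) _).of_eq (by simp [T, srchSt, scSt, un]) (by simp [T, srchSt, scSt, un])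
  obtain ⟨B7, i7⟩ := runs_mulP (T (fun _ => []) [] (un F₀) [] (un E) [] [] [] []) F₀ E []
  have i7' : Runs mulP (T (fun _ => []) [] (un F₀) [] (un E) [] (un E) [] []).store
      (T (fun _ => []) [] (un F₀) [] (un E) [] [] (un (E * F₀)) []).store B7 :=
    (i7.of_eq (by simp [T, srchSt, scSt, s', srchBase]) le_rfl).init (by simp [T, srchSt, scSt, s', srchBase])
  have i8 : Runs (clear .xr) (T (fun _ => []) [] (un F₀) [] (un E) [] [] (un (E * F₀)) []).store
      (T (fun _ => []) [] [] [] (un E) [] [] (un (E * F₀)) []).store (2 * F₀ + 1) :=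
    (runs_clear (Γ := Bool) DReg.xr _).of_eq (by simp [T, srchSt, scSt]) (by simp [T, srchSt, scSt, un])
  have i9 : Runs (push DReg.go2 true) (T (fun _ => []) [] [] [] (un E) [] [] (un (E * F₀)) []).store
      (T (fun _ => []) [] [] [] (un E) [] [] (un (E * F₀)) [true]).store 1 := Runs.push' (by simp [T, srchSt, scSt])
  obtain ⟨B, cur', r', hl, hl1, hl2⟩ := runs_srchLoop s' P K m inp out hinp hout z (E * F₀) _ [] [] rfl (by simp)
  have hl' : Runs srchLoop (T (fun _ => []) [] [] [] (un E) [] [] (un (E * F₀)) [true]).store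
      (srchSt s' P K m inp out z cur' 0 r' []).store B := hl.init (by simp [T, srchSt, scSt, s', srchBase])
  have main := (i1.seq (i2.seq (i3.seq (i4.seq (i5.seq (i6.seq (i7'.seq i8))))))).seq (i9.seq hl')
  have hiff : r' = [true] ↔ ∃ v, v.length ≤ E * F₀ ∧ SimOK P K m inp out z v := by rw [hl1]; simp
  have h01 : r' = [] ∨ r' = [true] := by rcases hl2 with h | h | h <;> simp [h]
  exact ⟨_, cur', r', by rw [hT0]; unfold search srchInit; exact main, hiff, h01⟩

/-! ### The phases of the diagonalizer before the clocked segment -/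

/-- Two copies of `yr` reversed: onto `xx` and `xc`. [folklore] -/
def dupX : Prog Kf := loop .yr fun b => push .xx b ;; push .xc b

/-- Effect and cost of `dupX`. [folklore] -/
theorem runs_dupX (s : DSt Kf) (x a c : List Bool) :
    Runs dupX { s with yr := x.reverse, xx := a, xc := c }.store { s with yr := [], xx := x ++ a, xc := x ++ c }.store
      (4 * x.length + 1) := by
  have h := runs_loop_inv (k := DReg.yr) (f := fun b => push .xx b ;; push .xc b)
    (fun done rest => ({ s with yr := rest, xx := done ++ a, xc := done ++ c } : DSt Kf).store)
    (fun _ _ => True) 2 (fun _ _ _ => by simp)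
    (fun done b rest _ => ⟨trivial, by
      refine Runs.seq (R₁ := ({ s with yr := rest, xx := b :: (done ++ a), xc := done ++ c } : DSt Kf).store)
        (Runs.push' (by simp)) (Runs.push' (by simp))⟩)
    x.reverse [] trivial
  exact (h.of_eq (by simp) (by simp)).init (by simp)

/-- **`inPhase`**: un-pair the input `⟨x, w⟩` on `inreg`: `inreg := w`, `xx := x`, `xc := x`.
[folklore] -/
def inPhase : Prog Kf := pour .inreg .t1 ;; pour .t1 .xr ;; unpairTr ;; pour .xr .t1 ;; pour .t1 .inreg ;; dupX

/-- Effect and cost of `inPhase`. [folklore] -/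
theorem runs_inPhase (s : DSt Kf) (x w : List Bool) :
    Runs inPhase { s with inreg := boolPair x w, t1 := [], xr := [], yr := [], go := [], xx := [], xc := [] }.store
      { s with inreg := w, t1 := [], xr := [], yr := [], go := [], xx := x, xc := x }.store
      (24 * x.length + 12 * w.length + 25) := by
  let T : List Bool → List Bool → List Bool → List Bool → List Bool → List Bool → DSt Kf := fun i t xr yr xx xc =>
    { s with inreg := i, t1 := t, xr := xr, yr := yr, go := [], xx := xx, xc := xc }
  have e1 : Runs (pour .inreg .t1) (T (boolPair x w) [] [] [] [] []).store (T [] (boolPair x w).reverse [] [] [] []).store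
      (3 * (boolPair x w).length + 1) :=
    (runs_pour (Γ := Bool) (a := DReg.inreg) (b := DReg.t1) (by simp) _).of_eq (by simp [T]) (by simp [T])
  have e2 : Runs (pour .t1 .xr) (T [] (boolPair x w).reverse [] [] [] []).store (T [] [] (boolPair x w) [] [] []).store
      (3 * (boolPair x w).length + 1) :=
    (runs_pour (Γ := Bool) (a := DReg.t1) (b := DReg.xr) (by simp) _).of_eq (by simp [T]) (by simp [T])
  have e3 : Runs unpairTr (T [] [] (boolPair x w) [] [] []).store (T [] [] w x.reverse [] []).store (1 + (8 * x.length + 7)) :=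
    (runs_unpairTr (T [] [] (boolPair x w) [] [] []) x w []).of_eq (by simp [T]) le_rfl |>.init (by simp [T])
  have e4 : Runs (pour .xr .t1) (T [] [] w x.reverse [] []).store (T [] w.reverse [] x.reverse [] []).store (3 * w.length + 1) :=
    (runs_pour (Γ := Bool) (a := DReg.xr) (b := DReg.t1) (by simp) _).of_eq (by simp [T]) (by simp [T])
  have e5 : Runs (pour .t1 .inreg) (T [] w.reverse [] x.reverse [] []).store (T w [] [] x.reverse [] []).store (3 * w.length + 1) :=
    (runs_pour (Γ := Bool) (a := DReg.t1) (b := DReg.inreg) (by simp) _).of_eq (by simp [T]) (by simp [T])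
  have e6 : Runs dupX (T w [] [] x.reverse [] []).store (T w [] [] [] x x).store (4 * x.length + 1) :=
    (runs_dupX (T w [] [] x.reverse [] []) x [] []).of_eq (by simp [T]) le_rfl |>.init (by simp [T])
  unfold inPhase
  refine Runs.mono (e1.seq (e2.seq (e3.seq (e4.seq (e5.seq e6))))) ?_
  simp only [length_boolPair]; omega

/-- **`hPhase inpf`**: from `xr = H⁻¹`: `hh := H`, `h2 := H`, `zz := H ++ [0]` (the first word of
the chain), and `1^{|H|+1}` on the input register `inpf` of the clock program. [folklore] -/
def hPhase (inpf : Fin Kf) : Prog Kf :=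
  push .zz false ;; (loop .xr fun b => push .hh b ;; push .h2 b ;; push .zz b ;; push (.pf inpf) true) ;; push (.pf inpf) true

/-- Effect and cost of `hPhase`. [folklore] -/
theorem runs_hPhase (s : DSt Kf) (inpf : Fin Kf) (H : List Bool) (hpf : s.pf inpf = []) :
    Runs (hPhase inpf) { s with xr := H.reverse, hh := [], h2 := [], zz := [] }.store
      { s with xr := [], hh := H, h2 := H, zz := H ++ [false], pf := update s.pf inpf (un (H.length + 1)) }.store
      (1 + (6 * H.length + 1) + 1) := by
  let T : List Bool → List Bool → List Bool → List Bool → ℕ → DSt Kf := fun xr hh hb zz n =>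
    { s with xr := xr, hh := hh, h2 := hb, zz := zz, pf := update s.pf inpf (un n) }
  have hpf0 : update s.pf inpf [] = s.pf := by rw [← hpf]; exact update_eq_self _ _
  have e0 : Runs (push DReg.zz false) (T H.reverse [] [] [] 0).store (T H.reverse [] [] [false] 0).store 1 := Runs.push' (by simp [T])
  have STEP : ∀ (done : List Bool) (b : Bool) (rest : List Bool),
      Runs (push .hh b ;; push .h2 b ;; push .zz b ;; push (.pf inpf) true) (update (T (b :: rest) done done (done ++ [false]) done.length).store .xr rest)
        (T rest (b :: done) (b :: done) ((b :: done) ++ [false]) (b :: done).length).store 4 := by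
    intro done b rest
    have p1 : Runs (push DReg.hh b) (T rest done done (done ++ [false]) done.length).store
        (T rest (b :: done) done (done ++ [false]) done.length).store 1 := Runs.push' (by simp [T])
    have p2 : Runs (push DReg.h2 b) (T rest (b :: done) done (done ++ [false]) done.length).store
        (T rest (b :: done) (b :: done) (done ++ [false]) done.length).store 1 := Runs.push' (by simp [T])
    have p3 : Runs (push DReg.zz b) (T rest (b :: done) (b :: done) (done ++ [false]) done.length).store
        (T rest (b :: done) (b :: done) (b :: (done ++ [false])) done.length).store 1 := Runs.push' (by simp [T])
    have p4 : Runs (push (DReg.pf inpf) true) (T rest (b :: done) (b :: done) (b :: (done ++ [false])) done.length).store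
        (T rest (b :: done) (b :: done) (b :: (done ++ [false])) (done.length + 1)).store 1 :=
      Runs.push' (by simp [T, un, List.replicate_succ])
    exact ((p1.seq (p2.seq (p3.seq p4))).init (by simp [T])).of_eq (by simp [T]) (by omega)
  have e1 := runs_loop_inv (k := DReg.xr) (f := fun b => push .hh b ;; push .h2 b ;; push .zz b ;; push (.pf inpf) true)
    (fun done rest => (T rest done done (done ++ [false]) done.length).store) (fun _ _ => True) 4 (fun _ _ _ => by simp [T])
    (fun done b rest _ => ⟨trivial, STEP done b rest⟩) H.reverse [] trivial
  have e1' : Runs (loop .xr fun b => push .hh b ;; push .h2 b ;; push .zz b ;; push (.pf inpf) true) (T H.reverse [] [] [false] 0).store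
      (T [] H H (H ++ [false]) H.length).store (6 * H.length + 1) := (e1.of_eq (by simp) (by simp)).init (by simp [T])
  have e2 : Runs (push (DReg.pf inpf) true) (T [] H H (H ++ [false]) H.length).store (T [] H H (H ++ [false]) (H.length + 1)).store 1 :=
    Runs.push' (by simp [T, un, List.replicate_succ])
  unfold hPhase
  exact ((e0.seq (e1'.seq e2)).init (by simp [T, hpf0])).of_eq (by simp [T]) le_rfl

/-- The header-and-pad word read off `H`: its first component if `H` is a pair word, else
nothing. [folklore] -/
def bOf (H : List Bool) : List Bool :=
  match DiagPrelims.unpair H with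
  | some p => p.1
  | none => []

/-- After un-pairing `H`: keep the header word, drop the pad (or everything if malformed).
[folklore] -/
def bBr : Option Bool → Prog Kf
  | some _ => clear .xr ;; clear .yr
  | none => clear .xr ;; pour .yr .bb

/-- **`bPhase`**: `bb := bOf hh` (consuming `hh`). [folklore] -/
def bPhase : Prog Kf := pour .hh .t1 ;; pour .t1 .xr ;; unpairTr ;; pop .bad bBr

/-- Effect and cost of `bPhase`. [folklore] -/
theorem runs_bPhase (s : DSt Kf) (H : List Bool) :
    Runs bPhase { s with hh := H, t1 := [], xr := [], yr := [], go := [], bad := [], bb := [] }.store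
      { s with hh := [], t1 := [], xr := [], yr := [], go := [], bad := [], bb := bOf H }.store (19 * H.length + 16) := by
  let T : List Bool → List Bool → List Bool → List Bool → List Bool → List Bool → DSt Kf := fun hh t xr yr bad bb =>
    { s with hh := hh, t1 := t, xr := xr, yr := yr, go := [], bad := bad, bb := bb }
  have e1 : Runs (pour .hh .t1) (T H [] [] [] [] []).store (T [] H.reverse [] [] [] []).store (3 * H.length + 1) :=
    (runs_pour (Γ := Bool) (a := DReg.hh) (b := DReg.t1) (by simp) _).of_eq (by simp [T]) (by simp [T])
  have e2 : Runs (pour .t1 .xr) (T [] H.reverse [] [] [] []).store (T [] [] H [] [] []).store (3 * H.length + 1) :=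
    (runs_pour (Γ := Bool) (a := DReg.t1) (b := DReg.xr) (by simp) _).of_eq (by simp [T]) (by simp [T])
  unfold bPhase
  rcases hu : DiagPrelims.unpair H with _ | ⟨b, pad⟩
  · obtain ⟨xr', yr', e3, hl⟩ := runs_unpairTr_none (T [] [] H [] [] []) H [] [] hu
    have e3' : Runs unpairTr (T [] [] H [] [] []).store (T [] [] xr' yr' [true] []).store (1 + (8 * H.length + 7)) :=
      (e3.of_eq (by simp [T]) le_rfl).init (by simp [T])
    have c1 : Runs (clear .xr) (T [] [] xr' yr' [] []).store (T [] [] [] yr' [] []).store (2 * xr'.length + 1) :=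
      (runs_clear (Γ := Bool) DReg.xr _).of_eq (by simp [T]) (by simp [T])
    have c2 : Runs (clear .yr) (T [] [] [] yr' [] []).store (T [] [] [] [] [] []).store (2 * yr'.length + 1) :=
      (runs_clear (Γ := Bool) DReg.yr _).of_eq (by simp [T]) (by simp [T])
    have e4 : Runs (pop .bad bBr) (T [] [] xr' yr' [true] []).store (T [] [] [] [] [] []).store ((2 * xr'.length + 1 + (2 * yr'.length + 1)) + 2) :=
      Runs.pop_cons' (f := bBr) (a := true) (w := []) (by simp [T]) (by simp [T]) (c1.seq c2)
    refine Runs.of_eq (e1.seq (e2.seq (e3'.seq e4))) (by simp [T, bOf, hu]) ?_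
    simp only [List.length_nil] at hl; omega
  · have hH := DiagPrelims.eq_boolPair_of_unpair hu
    have e3 : Runs unpairTr (T [] [] H [] [] []).store (T [] [] pad b.reverse [] []).store (1 + (8 * b.length + 7)) :=
      (runs_unpairTr (T [] [] H [] [] []) b pad []).of_eq (by simp [T]) le_rfl |>.init (by simp [T, hH])
    have c1 : Runs (clear .xr) (T [] [] pad b.reverse [] []).store (T [] [] [] b.reverse [] []).store (2 * pad.length + 1) :=
      (runs_clear (Γ := Bool) DReg.xr _).of_eq (by simp [T]) (by simp [T])
    have c2 : Runs (pour .yr .bb) (T [] [] [] b.reverse [] []).store (T [] [] [] [] [] b).store (3 * b.length + 1) :=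
      (runs_pour (Γ := Bool) (a := DReg.yr) (b := DReg.bb) (by simp) _).of_eq (by simp [T]) (by simp [T])
    have e4 : Runs (pop .bad bBr) (T [] [] pad b.reverse [] []).store (T [] [] [] [] [] b).store ((2 * pad.length + 1 + (3 * b.length + 1)) + 2) :=
      Runs.pop_nil (by simp [T]) (c1.seq c2)
    have hl : 2 * b.length + 2 + pad.length = H.length := by rw [hH, length_boolPair]
    refine Runs.of_eq (e1.seq (e2.seq (e3.seq e4))) (by simp [T, bOf, hu]) ?_
    omega

/-- **`svPhase`**: the answer at a simulated position, computed ahead and saved on `sv`: is the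
witness `w` (on `inreg`) a pair `⟨y, t⟩` with `t` a paid accepted transcript on `⟨x ++ [1], y⟩`?
Afterwards `zz` is reset to the first word `h2 ++ [0]` of the chain for the search. [folklore] -/
def svPhase : Prog Kf :=
  clear .zz ;; push .zz true ;; copy2 .xx .t1 .t2 ;; pour .t1 .xx ;; pour .t2 .zz ;; pour .inreg .t1 ;; pour .t1 .xr ;;
  simCore ;; pour .vd .sv ;; clear .zz ;; push .zz false ;; pour .h2 .t1 ;; pour .t1 .zz

/-- The store before `svPhase`: header fields read, `zz` holding the first chain word, the
input copy on `xx`, the witness on `inreg`. [folklore] -/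
def svSt (s : DSt Kf) (P : UFlat.UProg) (K m inp out : ℕ) (x w z : List Bool) (sv h2 : List Bool) : DSt Kf :=
  { (scSt s P K m inp out z []) with xx := x, inreg := w, t2 := [], sv := sv, h2 := h2 }

/-- **Effect, cost and verdict of `svPhase`.** [folklore] -/
theorem runs_svPhase (s : DSt Kf) (P : UFlat.UProg) (K m inp out : ℕ) (hinp : inp ≤ K) (hout : out ≤ K)
    (x w H z : List Bool) : ∃ sv : List Bool,
      Runs svPhase (svSt s P K m inp out x w z [] H).store (svSt s P K m inp out x [] (H ++ [false]) sv []).store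
        (scConst * (ssize (svSt s P K m inp out x w z [] H).store + 13 * x.length + 6 * w.length + 2 * z.length + 8) +
          20 * (x.length + w.length + H.length + z.length) + 20) ∧
      (sv = [] ∨ sv = [true]) ∧ (sv = [true] ↔ SimOK P K m inp out (x ++ [true]) w) := by
  -- the stores met: `T zz xx t1 t2 inreg xr vd sv h2`
  let T : List Bool → List Bool → List Bool → List Bool → List Bool → List Bool → List Bool → List Bool → List Bool → DSt Kf :=
    fun zz xx t1 t2 i xr vd sv h2 => { (scSt s P K m inp out zz xr) with xx := xx, inreg := i, t1 := t1, t2 := t2, vd := vd, sv := sv, h2 := h2 }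
  have hT0 : svSt s P K m inp out x w z [] H = T z x [] [] w [] [] [] H := by simp [svSt, T, scSt]
  have e1 : Runs (clear .zz) (T z x [] [] w [] [] [] H).store (T [] x [] [] w [] [] [] H).store (2 * z.length + 1) :=
    (runs_clear (Γ := Bool) DReg.zz _).of_eq (by simp [T, scSt]) (by simp [T, scSt])
  have e2 : Runs (push DReg.zz true) (T [] x [] [] w [] [] [] H).store (T [true] x [] [] w [] [] [] H).store 1 := Runs.push' (by simp [T, scSt])
  have e3 : Runs (copy2 .xx .t1 .t2) (T [true] x [] [] w [] [] [] H).store (T [true] [] x.reverse x.reverse w [] [] [] H).store (4 * x.length + 1) :=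
    (runs_copy2 (Γ := Bool) (a := DReg.xx) (b := DReg.t1) (c := DReg.t2) (by simp) (by simp) (by simp) _).of_eq
      (by simp [T, scSt]) (by simp [T, scSt])
  have e4 : Runs (pour .t1 .xx) (T [true] [] x.reverse x.reverse w [] [] [] H).store (T [true] x [] x.reverse w [] [] [] H).store
      (3 * x.length + 1) := (runs_pour (Γ := Bool) (a := DReg.t1) (b := DReg.xx) (by simp) _).of_eq (by simp [T, scSt]) (by simp [T, scSt])
  have e5 : Runs (pour .t2 .zz) (T [true] x [] x.reverse w [] [] [] H).store (T (x ++ [true]) x [] [] w [] [] [] H).store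
      (3 * x.length + 1) := (runs_pour (Γ := Bool) (a := DReg.t2) (b := DReg.zz) (by simp) _).of_eq (by simp [T, scSt]) (by simp [T, scSt])
  have e6 : Runs (pour .inreg .t1) (T (x ++ [true]) x [] [] w [] [] [] H).store (T (x ++ [true]) x w.reverse [] [] [] [] [] H).store
      (3 * w.length + 1) := (runs_pour (Γ := Bool) (a := DReg.inreg) (b := DReg.t1) (by simp) _).of_eq (by simp [T, scSt]) (by simp [T, scSt])
  have e7 : Runs (pour .t1 .xr) (T (x ++ [true]) x w.reverse [] [] [] [] [] H).store (T (x ++ [true]) x [] [] [] w [] [] H).store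
      (3 * w.length + 1) := (runs_pour (Γ := Bool) (a := DReg.t1) (b := DReg.xr) (by simp) _).of_eq (by simp [T, scSt]) (by simp [T, scSt])
  obtain ⟨vd, e8, hvd, hvd'⟩ := runs_simCore ({ s with xx := x, inreg := [], t2 := [], sv := [], h2 := H } : DSt Kf) P K m inp out hinp hout (x ++ [true]) w
  have e8' : Runs simCore (T (x ++ [true]) x [] [] [] w [] [] H).store (T (x ++ [true]) x [] [] [] [] vd [] H).store _ :=
    (e8.of_eq (by simp [T, scSt]) le_rfl).init (by simp [T, scSt])
  have e9 : Runs (pour .vd .sv) (T (x ++ [true]) x [] [] [] [] vd [] H).store (T (x ++ [true]) x [] [] [] [] [] vd.reverse H).store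
      (3 * vd.length + 1) := (runs_pour (Γ := Bool) (a := DReg.vd) (b := DReg.sv) (by simp) _).of_eq (by simp [T, scSt]) (by simp [T, scSt])
  have e10 : Runs (clear .zz) (T (x ++ [true]) x [] [] [] [] [] vd.reverse H).store (T [] x [] [] [] [] [] vd.reverse H).store
      (2 * (x ++ [true]).length + 1) := (runs_clear (Γ := Bool) DReg.zz _).of_eq (by simp [T, scSt]) (by simp [T, scSt])
  have e11 : Runs (push DReg.zz false) (T [] x [] [] [] [] [] vd.reverse H).store (T [false] x [] [] [] [] [] vd.reverse H).store 1 :=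
    Runs.push' (by simp [T, scSt])
  have e12 : Runs (pour .h2 .t1) (T [false] x [] [] [] [] [] vd.reverse H).store (T [false] x H.reverse [] [] [] [] vd.reverse []).store
      (3 * H.length + 1) := (runs_pour (Γ := Bool) (a := DReg.h2) (b := DReg.t1) (by simp) _).of_eq (by simp [T, scSt]) (by simp [T, scSt])
  have e13 : Runs (pour .t1 .zz) (T [false] x H.reverse [] [] [] [] vd.reverse []).store (T (H ++ [false]) x [] [] [] [] [] vd.reverse []).store
      (3 * H.length + 1) := (runs_pour (Γ := Bool) (a := DReg.t1) (b := DReg.zz) (by simp) _).of_eq (by simp [T, scSt]) (by simp [T, scSt])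
  have hvl : vd.length ≤ 1 := by rcases hvd with rfl | rfl <;> simp
  have hvr : vd.reverse = vd := by rcases hvd with rfl | rfl <;> simp
  -- the size of the `simCore` input store against the initial one
  have hsz : ssize (scSt ({ s with xx := x, inreg := [], t2 := [], sv := [], h2 := H } : DSt Kf) P K m inp out (x ++ [true]) w).store ≤
      ssize (svSt s P K m inp out x w z [] H).store + 13 * x.length + 6 * w.length + 2 * z.length + 7 := by
    obtain ⟨t, ht, ex⟩ := e1.seq (e2.seq (e3.seq (e4.seq (e5.seq (e6.seq e7)))))
    have h := ex.ssize_le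
    have e : (T (x ++ [true]) x [] [] [] w [] [] H) =
        scSt ({ s with xx := x, inreg := [], t2 := [], sv := [], h2 := H } : DSt Kf) P K m inp out (x ++ [true]) w := by
      simp [T, scSt]
    rw [← hT0, e] at h
    omega
  have main := e1.seq (e2.seq (e3.seq (e4.seq (e5.seq (e6.seq (e7.seq (e8'.seq (e9.seq (e10.seq (e11.seq (e12.seq e13)))))))))))
  refine ⟨vd.reverse, ?_, by rw [hvr]; exact hvd, by rw [hvr]; exact hvd'⟩
  unfold svPhase
  refine Runs.of_eq (main.init (by rw [hT0])) (by simp [svSt, T, scSt]) ?_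
  have hsc : scConst * (ssize (scSt ({ s with xx := x, inreg := [], t2 := [], sv := [], h2 := H } : DSt Kf) P K m inp out (x ++ [true]) w).store + 1) ≤
      scConst * (ssize (svSt s P K m inp out x w z [] H).store + 13 * x.length + 6 * w.length + 2 * z.length + 8) :=
    Nat.mul_le_mul_left _ (by omega)
  simp only [List.length_append, List.length_singleton]
  omega

end Diag

end Literature.Computability.Complexity
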